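import Mathlib
import Literature.Probability.Percolation.DiagonalStripReflectedRoots
import HarnessLib

/-!
# The wheel space: uniqueness and minimal degree of symmetric wheel polynomials (IP12 Prop. 3.4)

Topic `Literature/Probability/Percolation`. The proof of Ikhlef–Ponsaing (J. Stat. Phys. 149 (2012),
arXiv:1202.5476) Prop. 3.4 (`Z_L = χ_L(z²)`) runs: the sum `Z_L` of the qKZ ground state is symmetric,
invariant under `z_i → 1/z_i`, satisfies the recursion (27) on `z_j = q z_i` and has a degree "set by the
qKZ equation", and "these recursions are enough to satisfy the degree"; the character satisfies the same
recursions (26). This file isolates the rigorous mechanism behind that sentence, in the variables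
`U_k = z_k²` (plain `X k` here; `ω = q²` a primitive cube root of unity):

* `IsWheelPoly ω u L D B G` — `G ∈ K₀[X_u, …, X_{u+L-1}]` symmetric, palindromic of formal degree `D` in
  every variable (`ι_n G · z_n^D = G` in the rapidity field), with pair sums `≤ B` on its support, and
  satisfying the WHEEL CONDITION: the substitution `X_j ↦ ω X_i, X_k ↦ ω² X_i` (`wheelSub`) kills it.
* **`IsWheelPoly.eq_zero_of_res_eq_zero`** — a wheel polynomial vanishing on the hyperplane
  `X_{u+1} = ω X_u` (`resEta`) is zero: as a polynomial in `X_u` over the rapidity field (`rapUni`) it has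
  the `4(L-1)` distinct roots `ω^{±1} z_j^{±1}` against a degree `≤ D`.
* **`IsWheelPoly.restrict`** — if `B ≤ L + D` (as many roots as width), the restriction of a wheel
  polynomial in `L+2` variables factorises as `c' · X_u^{2D-B} · ∏_ℓ (X_u - ω X_ℓ)(X_ℓ X_u - ω)`
  (`wheelE`; IP12's `∏ k(u_i,u_ℓ)` up to a monomial) with `c'` a wheel polynomial in the remaining `L`
  variables of formal degree `D - 2` and pair bound `B - 4` (lower pair bound by double palindromicity;
  the roots `ω z_ℓ` from the wheel condition at `(ℓ, u, u+1)` and `ω z_ℓ⁻¹` by reciprocity; Euclid in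
  `F[T]`; the cofactor is a polynomial after peeling the primes `X_ℓ`; its pair bounds through the
  substitution `X_b ↦ X_a X_b` (`pairMap`, `pairDeg_mul`)).
* **`IsWheelPoly.two_mul_le_of_res_ne_zero`**, **`IsWheelPoly.eq_zero_deficient_odd`** — the converse
  count (a nonzero restriction forces `L + D ≤ B`) and the resulting MINIMAL DEGREE theorem: there is no
  nonzero wheel polynomial with the deficient odd parameters `(2k+3, 2k+1, 4k+2)`.
* **`IsWheelPoly.proportional_odd`**, **`IsWheelPoly.proportional_even`** — UNIQUENESS: for the
  parameters `(2m+1, 2m, 4m-1)` (those of `Z_{2m+1}` and `χ_{2m+1}`) and `(2m+2, 2m, 4m)` (those of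
  `χ_{2m+2}`) any two wheel polynomials are proportional (induction on `m` by restriction).
* `IsWheelPoly.of_base` — constructor from symmetric base data.

With the symplectic character shown to be a wheel polynomial (downstream) this gives `Z = κ χ_L(z²)`
(IP12 Prop. 3.4) from the EXISTENCE of a polynomial solution of the right degree, and the recursion (26).

## References

* Y. Ikhlef, A. K. Ponsaing, *Finite-size left-passage probability in percolation*, J. Stat. Phys.
  149 (2012) 10–36, arXiv:1202.5476, §3.4 (25), §3.6 (26)–(27) and proof of Prop. 3.4. [IkhlefPonsaing2012]
-/

namespace Literature.Probability.Percolation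

open Finset

/-! ### Pair degrees and the substitution `X_b ↦ X_a X_b` -/

section PairDeg

open MvPolynomial

variable {K₀ : Type*} [Field K₀]

/-- Degree of a substitution in one variable, weighted by the degrees of the substituted values.
[folklore] -/
theorem degreeOf_aeval_le (v : ℕ → MvPolynomial ℕ K₀) (n : ℕ) (w : ℕ → ℕ) (hw : ∀ i, (v i).degreeOf n ≤ w i)
    (f : MvPolynomial ℕ K₀) :
    (aeval v f).degreeOf n ≤ f.support.sup fun s => ∑ i ∈ s.support, s i * w i := by
  classical
  conv_lhs => rw [f.as_sum, map_sum]
  refine (degreeOf_sum_le _ _ _).trans (Finset.sup_mono_fun fun s _ => ?_)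
  rw [aeval_monomial, Finsupp.prod]
  refine (degreeOf_mul_le _ _ _).trans ?_
  rw [MvPolynomial.algebraMap_eq, degreeOf_C, zero_add]
  refine (degreeOf_prod_le _ _ _).trans (Finset.sum_le_sum fun i _ => ?_)
  exact (degreeOf_pow_le _ _ _).trans (Nat.mul_le_mul_left _ (hw i))

/-- **The pair degree** `max_{s ∈ supp f} (s a + s b)`. [folklore] -/
def pairDeg (a b : ℕ) (f : MvPolynomial ℕ K₀) : ℕ := f.support.sup fun s => s a + s b

/-- The pair degree bounds every pair sum on the support. [folklore] -/
theorem pairDeg_le_iff {a b : ℕ} {f : MvPolynomial ℕ K₀} {B : ℕ} :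
    pairDeg a b f ≤ B ↔ ∀ s ∈ f.support, s a + s b ≤ B := by
  unfold pairDeg; exact Finset.sup_le_iff

/-- The exponent map of `X_b ↦ X_a X_b`. [folklore] -/
noncomputable def pairExp (a b : ℕ) (s : ℕ →₀ ℕ) : ℕ →₀ ℕ := s + Finsupp.single a (s b)

/-- The exponent map is injective (`a ≠ b`). [folklore] -/
theorem pairExp_injective {a b : ℕ} (hab : a ≠ b) : Function.Injective (pairExp a b) := by
  intro s t h
  have hb : s b = t b := by
    have := congrArg (fun e => e b) h
    simpa [pairExp, Finsupp.single_apply, hab] using this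
  have : s + Finsupp.single a (s b) = t + Finsupp.single a (s b) := by
    have h' := h; unfold pairExp at h'; rwa [← hb] at h'
  exact add_right_cancel this

variable (K₀) in
/-- **The substitution `X_b ↦ X_a X_b`** (it adds the `b`-exponent to the `a`-exponent). [folklore] -/
noncomputable def pairMap (a b : ℕ) : MvPolynomial ℕ K₀ →ₐ[K₀] MvPolynomial ℕ K₀ :=
  aeval (Function.update (fun k => (X k : MvPolynomial ℕ K₀)) b (X a * X b))

/-- The substitution on a monomial. [folklore] -/
theorem pairMap_monomial (a b : ℕ) (s : ℕ →₀ ℕ) (c : K₀) :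
    pairMap K₀ a b (monomial s c) = monomial (pairExp a b s) c := by
  classical
  rw [pairMap, aeval_monomial, MvPolynomial.algebraMap_eq, pairExp, monomial_eq (s := s + _), Finsupp.prod_add_index',
    Finsupp.prod_single_index]
  · congr 1
    -- split the product over the support at `b`
    have hs : s.support ⊆ insert b s.support := Finset.subset_insert _ _
    rw [Finsupp.prod_of_support_subset s hs _ (fun i _ => pow_zero _),
      Finsupp.prod_of_support_subset s hs _ (fun i _ => pow_zero _),
      ← Finset.mul_prod_erase _ _ (Finset.mem_insert_self b s.support),
      ← Finset.mul_prod_erase _ _ (Finset.mem_insert_self b s.support), Function.update_self, mul_pow]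
    have hprod : ∏ x ∈ (insert b s.support).erase b, Function.update (fun k => X k) b (X a * X b) x ^ s x =
        ∏ x ∈ (insert b s.support).erase b, (X x : MvPolynomial ℕ K₀) ^ s x :=
      Finset.prod_congr rfl fun i hi => by rw [Function.update_of_ne (Finset.mem_erase.1 hi).1]
    rw [hprod]
    ring
  · exact pow_zero _
  · intro i; exact pow_zero _
  · intro i m n; exact pow_add _ _ _

/-- The substitution as a sum of monomials. [folklore] -/
theorem pairMap_eq_sum (a b : ℕ) (f : MvPolynomial ℕ K₀) :
    pairMap K₀ a b f = ∑ s ∈ f.support, monomial (pairExp a b s) (coeff s f) := by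
  conv_lhs => rw [f.as_sum, map_sum]
  exact Finset.sum_congr rfl fun s _ => pairMap_monomial a b s _

/-- **The substitution preserves coefficients** along the exponent map. [folklore] -/
theorem coeff_pairMap {a b : ℕ} (hab : a ≠ b) (f : MvPolynomial ℕ K₀) (s : ℕ →₀ ℕ) :
    coeff (pairExp a b s) (pairMap K₀ a b f) = coeff s f := by
  classical
  rw [pairMap_eq_sum a b, coeff_sum]
  simp only [coeff_monomial]
  rw [Finset.sum_eq_single s]
  · rw [if_pos rfl]
  · intro t _ hts
    rw [if_neg fun h => hts (pairExp_injective hab h)]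
  · intro hs
    rw [if_pos rfl]
    exact (notMem_support_iff.1 hs)

/-- The substitution is injective. [folklore] -/
theorem pairMap_ne_zero {a b : ℕ} (hab : a ≠ b) {f : MvPolynomial ℕ K₀} (hf : f ≠ 0) : pairMap K₀ a b f ≠ 0 := by
  obtain ⟨s, hs⟩ : f.support.Nonempty := Finset.nonempty_of_ne_empty fun h => hf (support_eq_empty.1 h)
  intro h0
  have := coeff_pairMap hab f s
  rw [h0, coeff_zero] at this
  exact (mem_support_iff.1 hs) this.symm

/-- **The pair degree is the `X_a`-degree after the substitution.** [folklore] -/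
theorem degreeOf_pairMap {a b : ℕ} (hab : a ≠ b) (f : MvPolynomial ℕ K₀) :
    (pairMap K₀ a b f).degreeOf a = pairDeg a b f := by
  classical
  apply le_antisymm
  · rw [pairMap_eq_sum a b]
    refine (degreeOf_sum_le _ _ _).trans (Finset.sup_mono_fun fun s hs => ?_)
    rw [degreeOf_monomial_eq _ _ (mem_support_iff.1 hs)]
    simp [pairExp]
  · refine Finset.sup_le fun s hs => ?_
    have hmem : pairExp a b s ∈ (pairMap K₀ a b f).support := by
      rw [mem_support_iff, coeff_pairMap hab]; exact mem_support_iff.1 hs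
    have := monomial_le_degreeOf a hmem
    simpa [pairExp, Finsupp.single_apply] using this

/-- **The pair degree is additive on products** (in the domain `K₀[X]`). [folklore] -/
theorem pairDeg_mul {a b : ℕ} (hab : a ≠ b) {f g : MvPolynomial ℕ K₀} (hf : f ≠ 0) (hg : g ≠ 0) :
    pairDeg a b (f * g) = pairDeg a b f + pairDeg a b g := by
  rw [← degreeOf_pairMap hab, ← degreeOf_pairMap hab, ← degreeOf_pairMap hab, map_mul,
    degreeOf_mul_eq (pairMap_ne_zero hab hf) (pairMap_ne_zero hab hg)]

/-- The pair degree of a product of nonzero factors. [folklore] -/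
theorem pairDeg_prod {a b : ℕ} (hab : a ≠ b) {ι : Type*} (s : Finset ι) (f : ι → MvPolynomial ℕ K₀)
    (hf : ∀ i ∈ s, f i ≠ 0) : pairDeg a b (∏ i ∈ s, f i) = ∑ i ∈ s, pairDeg a b (f i) := by
  classical
  induction s using Finset.induction_on with
  | empty => simp [pairDeg]
  | insert i s his ih =>
    rw [Finset.prod_insert his, Finset.sum_insert his,
      pairDeg_mul hab (hf i (Finset.mem_insert_self i s)) (Finset.prod_ne_zero_iff.2 fun j hj =>
        hf j (Finset.mem_insert_of_mem hj)), ih fun j hj => hf j (Finset.mem_insert_of_mem hj)]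

/-- The pair degree is symmetric in the pair. [folklore] -/
theorem pairDeg_comm (a b : ℕ) (f : MvPolynomial ℕ K₀) : pairDeg a b f = pairDeg b a f := by
  unfold pairDeg; congr 1; ext t; exact Nat.add_comm _ _

/-- A pair sum on the support is at most the pair degree. [folklore] -/
theorem le_pairDeg {a b : ℕ} {f : MvPolynomial ℕ K₀} {s : ℕ →₀ ℕ} (hs : s ∈ f.support) : s a + s b ≤ pairDeg a b f :=
  Finset.le_sup (f := fun t : ℕ →₀ ℕ => t a + t b) hs

/-- The pair degree is bounded by the sum of the two degrees. [folklore] -/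
theorem pairDeg_le_degreeOf_add (a b : ℕ) (f : MvPolynomial ℕ K₀) : pairDeg a b f ≤ f.degreeOf a + f.degreeOf b :=
  Finset.sup_le fun _ hs => Nat.add_le_add (monomial_le_degreeOf a hs) (monomial_le_degreeOf b hs)

end PairDeg

/-! ### Palindromic polynomials: coefficient symmetry and the two forms -/

section Palindromic

open MvPolynomial

variable {K₀ : Type*} [Field K₀]

/-- Reversal of exponents is an involution below the bound. [folklore] -/
theorem revExp_revExp {k N : ℕ} {e : ℕ →₀ ℕ} (h : e k ≤ N) : revExp k N (revExp k N e) = e := by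
  ext n
  by_cases hn : n = k
  · subst hn; rw [revExp_apply_self, revExp_apply_self]; omega
  · rw [revExp_apply_of_ne _ hn, revExp_apply_of_ne _ hn]

/-- **Coefficients of the reversed polynomial.** [folklore] -/
theorem coeff_revPoly {k N : ℕ} {P : MvPolynomial ℕ K₀} (hN : P.degreeOf k ≤ N) {t : ℕ →₀ ℕ} (ht : t k ≤ N) :
    (revPoly k N P).coeff t = P.coeff (revExp k N t) := by
  classical
  rw [revPoly, coeff_sum]
  simp only [coeff_monomial]
  rw [Finset.sum_eq_single (revExp k N t)]
  · rw [if_pos (revExp_revExp ht)]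
  · intro e he hne
    rw [if_neg]
    intro h
    apply hne
    rw [← h, revExp_revExp ((monomial_le_degreeOf k he).trans hN)]
  · intro h
    rw [if_pos (revExp_revExp ht)]
    exact notMem_support_iff.1 h

/-- **A palindromic polynomial has a reversal-symmetric support.** [folklore] -/
theorem mem_support_revExp_of_revPoly_eq {k D : ℕ} {G : MvPolynomial ℕ K₀} (hdeg : G.degreeOf k ≤ D)
    (hpal : revPoly k D G = G) {s : ℕ →₀ ℕ} (hs : s ∈ G.support) : revExp k D s ∈ G.support := by
  have hsk : s k ≤ D := (monomial_le_degreeOf k hs).trans hdeg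
  rw [mem_support_iff] at hs ⊢
  have h := coeff_revPoly hdeg (t := revExp k D s) (by rw [revExp_apply_self]; omega)
  rw [hpal, revExp_revExp hsk] at h
  rwa [h]

/-- **Field form ⇒ polynomial form** of palindromicity: `ι_k(G) z_k^D = G` in the rapidity field gives
`revPoly k D G = G`. [folklore] -/
theorem revPoly_eq_self_of_genInv {k D : ℕ} {G : MvPolynomial ℕ K₀} (hdeg : G.degreeOf k ≤ D)
    (hpal : genInv K₀ k (toRF K₀ G) * genZ K₀ k ^ D = toRF K₀ G) : revPoly k D G = G := by
  apply toRF_injective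
  rw [← invSubst_mul_pow_eq k D G hdeg, ← genInv_toRF, hpal]

/-- **Polynomial form ⇒ field form.** [folklore] -/
theorem genInv_mul_pow_eq_of_revPoly {k D : ℕ} {G : MvPolynomial ℕ K₀} (hdeg : G.degreeOf k ≤ D)
    (hpal : revPoly k D G = G) : genInv K₀ k (toRF K₀ G) * genZ K₀ k ^ D = toRF K₀ G := by
  rw [genInv_toRF, invSubst_mul_pow_eq k D G hdeg, hpal]

/-- **Lower pair bound from double palindromicity**: if `G` is palindromic of formal degree `D` in
`X_a` and in `X_b` and its `(a,b)`-pair sums are `≤ B`, then they are also `≥ 2D - B`. [folklore] -/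
theorem pair_lower_of_palindromic {a b D B : ℕ} (hab : a ≠ b) {G : MvPolynomial ℕ K₀}
    (hda : G.degreeOf a ≤ D) (hdb : G.degreeOf b ≤ D) (hpa : revPoly a D G = G) (hpb : revPoly b D G = G)
    (hpair : ∀ s ∈ G.support, s a + s b ≤ B) {s : ℕ →₀ ℕ} (hs : s ∈ G.support) : 2 * D ≤ s a + s b + B := by
  have hsa : s a ≤ D := (monomial_le_degreeOf a hs).trans hda
  have hsb : s b ≤ D := (monomial_le_degreeOf b hs).trans hdb
  have h1 := mem_support_revExp_of_revPoly_eq hda hpa hs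
  have h2 := mem_support_revExp_of_revPoly_eq hdb hpb h1
  have h3 := hpair _ h2
  rw [revExp_apply_of_ne _ hab, revExp_apply_self, revExp_apply_self, revExp_apply_of_ne _ hab.symm] at h3
  omega

end Palindromic

/-! ### Substitution bookkeeping -/

section Substitutions

open MvPolynomial

variable {K₀ : Type*} [Field K₀]

/-- **Evaluating `rapUni u F` at the image of a polynomial is a substitution.** [folklore] -/
theorem eval_rapUni_toRF (u : ℕ) (g F : MvPolynomial ℕ K₀) :
    (rapUni K₀ u F).eval (toRF K₀ g) = toRF K₀ (substHom u g F) := by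
  have key : (Polynomial.evalRingHom (toRF K₀ g)).comp (rapUni K₀ u) = (toRF K₀).comp (substHom u g).toRingHom := by
    refine ringHom_ext (fun a => ?_) (fun k => ?_)
    · simp only [RingHom.comp_apply, rapUni_C, Polynomial.coe_evalRingHom, Polynomial.eval_C, AlgHom.toRingHom_eq_coe,
        RingHom.coe_coe, substHom_C]; rfl
    · simp only [RingHom.comp_apply, Polynomial.coe_evalRingHom, AlgHom.toRingHom_eq_coe, RingHom.coe_coe]
      by_cases hk : k = u
      · subst hk; rw [rapUni_X_self, Polynomial.eval_X, substHom_X_self]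
      · rw [rapUni_X_of_ne hk, Polynomial.eval_C, substHom_X_of_ne _ hk]; rfl
  have := RingHom.congr_fun key F
  simpa using this

/-- **Conjugating a substitution by a renaming.** [folklore] -/
theorem rename_substHom (σ : Equiv.Perm ℕ) (a : ℕ) (g F : MvPolynomial ℕ K₀) :
    rename σ (substHom a g F) = substHom (σ a) (rename σ g) (rename σ F) := by
  have key : (rename σ).comp (substHom a g) = (substHom (σ a) (rename σ g)).comp (rename σ) := by
    refine algHom_ext fun n => ?_
    simp only [AlgHom.coe_comp, Function.comp_apply, rename_X]
    by_cases hn : n = a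
    · subst hn; rw [substHom_X_self, substHom_X_self]
    · rw [substHom_X_of_ne _ hn, rename_X, substHom_X_of_ne _ (fun h => hn (σ.injective h))]
  exact congrArg (fun φ : MvPolynomial ℕ K₀ →ₐ[K₀] MvPolynomial ℕ K₀ => φ F) key

/-- **Two hyperplane substitutions compose to one when `ω³ = 1`**:
`(X_u ↦ ω² X_j) ∘ (X_j ↦ ω X_u) = (X_u ↦ ω² X_j)`. [folklore] -/
theorem substHom_comp_substHom_cube {ω : K₀} (hω3 : ω ^ 3 = 1) {u j : ℕ} (hju : j ≠ u) (F : MvPolynomial ℕ K₀) :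
    substHom u (C (ω ^ 2) * X j) (substHom j (C ω * X u) F) = substHom u (C (ω ^ 2) * X j) F := by
  have key : (substHom u (C (ω ^ 2) * X j)).comp (substHom j (C ω * X u)) =
      substHom u (C (ω ^ 2) * (X j : MvPolynomial ℕ K₀)) := by
    refine algHom_ext fun n => ?_
    simp only [AlgHom.coe_comp, Function.comp_apply]
    by_cases hn : n = j
    · subst hn
      rw [substHom_X_self, map_mul, substHom_C, substHom_X_self, substHom_X_of_ne _ hju, ← mul_assoc, ← C_mul,
        show ω * ω ^ 2 = ω ^ 3 by ring, hω3, C_1, one_mul]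
    · rw [substHom_X_of_ne _ hn]
  exact congrArg (fun φ : MvPolynomial ℕ K₀ →ₐ[K₀] MvPolynomial ℕ K₀ => φ F) key

/-- **Reciprocity of `rapUni u G` in `z_j`** for a polynomial palindromic of formal degree `D` in `X_j`
(`j ≠ u`): `(rapUni u G).map ι_j = C(z_j⁻¹)^D · rapUni u G`. [folklore] -/
theorem map_genInv_rapUni_of_revPoly {u j D : ℕ} (hju : j ≠ u) {G : MvPolynomial ℕ K₀} (hdeg : G.degreeOf j ≤ D)
    (hpal : revPoly j D G = G) :
    (rapUni K₀ u G).map (genInv K₀ j) = Polynomial.C ((genZ K₀ j)⁻¹) ^ D * rapUni K₀ u G := by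
  set h : MvPolynomial ℕ K₀ →+* Polynomial (RapidityField K₀) := (Polynomial.mapRingHom (genInv K₀ j)).comp (rapUni K₀ u)
    with hh
  have hz : genZ K₀ j ≠ 0 := genZ_ne_zero j
  have hrev := hom_revPoly_eq h (rapUni K₀ u) j D
    (fun a => by rw [hh, RingHom.comp_apply, rapUni_C, Polynomial.coe_mapRingHom, Polynomial.map_C, genInv_genC])
    (fun i hij => by
      rw [hh, RingHom.comp_apply, Polynomial.coe_mapRingHom]
      by_cases hiu : i = u
      · subst hiu; rw [rapUni_X_self, Polynomial.map_X]
      · rw [rapUni_X_of_ne hiu, Polynomial.map_C, genInv_genZ, Function.update_of_ne hij])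
    (by rw [hh, RingHom.comp_apply, Polynomial.coe_mapRingHom, rapUni_X_of_ne hju, Polynomial.map_C, genInv_genZ,
          Function.update_self, ← Polynomial.C_mul, mul_inv_cancel₀ hz, Polynomial.C_1])
    G hdeg
  rw [hpal] at hrev
  rw [hh, RingHom.comp_apply, Polynomial.coe_mapRingHom] at hrev
  rw [hrev, RingHom.comp_apply, Polynomial.coe_mapRingHom, rapUni_X_of_ne hju, Polynomial.map_C, genInv_genZ,
    Function.update_self]

/-- Roots are reflected: if `rapUni u G` vanishes at `r` and `G` is palindromic in `X_j` then it vanishes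
at `ι_j r`. [folklore] -/
theorem eval_rapUni_genInv_eq_zero {u j D : ℕ} (hju : j ≠ u) {G : MvPolynomial ℕ K₀} (hdeg : G.degreeOf j ≤ D)
    (hpal : revPoly j D G = G) {r : RapidityField K₀} (hr : (rapUni K₀ u G).eval r = 0) :
    (rapUni K₀ u G).eval (genInv K₀ j r) = 0 := by
  have h1 := Polynomial.eval_map_apply (p := rapUni K₀ u G) (genInv K₀ j) r
  rw [hr, map_zero, map_genInv_rapUni_of_revPoly hju hdeg hpal, Polynomial.eval_mul, Polynomial.eval_pow,
    Polynomial.eval_C] at h1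
  exact (mul_eq_zero.1 h1).resolve_left (pow_ne_zero _ (inv_ne_zero (genZ_ne_zero j)))

/-- **The roots `c z_j^{±1}` are pairwise distinct** for `c` in a set of nonzero constants. [folklore] -/
theorem genC_mul_genZ_inj {c c' : K₀} (hc : c ≠ 0) {j j' : ℕ} {b b' : Bool}
    (h : genC K₀ c * (if b then genZ K₀ j else (genZ K₀ j)⁻¹) = genC K₀ c' * (if b' then genZ K₀ j' else (genZ K₀ j')⁻¹)) :
    c = c' ∧ j = j' ∧ b = b' := by
  classical
  have hz := genZ_ne_zero (K₀ := K₀) j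
  have hz' := genZ_ne_zero (K₀ := K₀) j'
  set m : ℕ →₀ ℕ := if b then Finsupp.single j 2 + Finsupp.single j' 1 else Finsupp.single j' 1 with hm
  set m' : ℕ →₀ ℕ := if b' then Finsupp.single j' 2 + Finsupp.single j 1 else Finsupp.single j 1 with hm'
  have hmon : ∀ a d : ℕ, (monomial (Finsupp.single a 2 + Finsupp.single d 1)) (1 : K₀) = X a ^ 2 * X d := by
    intro a d; rw [X_pow_eq_monomial, X, monomial_mul, mul_one]
  have e1 : (if b then genZ K₀ j else (genZ K₀ j)⁻¹) * (genZ K₀ j * genZ K₀ j') = toRF K₀ (monomial m 1) := by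
    rw [hm]
    cases b
    · simp only [Bool.false_eq_true, ↓reduceIte]
      rw [← mul_assoc, inv_mul_cancel₀ hz, one_mul, ← X_pow_eq_monomial, pow_one]; rfl
    · simp only [↓reduceIte]
      rw [hmon, map_mul, map_pow]
      unfold genZ; ring
  have e2 : (if b' then genZ K₀ j' else (genZ K₀ j')⁻¹) * (genZ K₀ j * genZ K₀ j') = toRF K₀ (monomial m' 1) := by
    rw [hm']
    cases b'
    · simp only [Bool.false_eq_true, ↓reduceIte]
      rw [mul_comm (genZ K₀ j), ← mul_assoc, inv_mul_cancel₀ hz', one_mul, ← X_pow_eq_monomial, pow_one]; rfl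
    · simp only [↓reduceIte]
      rw [hmon, map_mul, map_pow]
      unfold genZ; ring
  have h2 : genC K₀ c * (if b then genZ K₀ j else (genZ K₀ j)⁻¹) * (genZ K₀ j * genZ K₀ j') =
      genC K₀ c' * (if b' then genZ K₀ j' else (genZ K₀ j')⁻¹) * (genZ K₀ j * genZ K₀ j') := by
    rw [h]
  rw [mul_assoc, mul_assoc, e1, e2, show genC K₀ c = toRF K₀ (C c) from rfl, show genC K₀ c' = toRF K₀ (C c') from rfl,
    ← map_mul, ← map_mul, C_mul_monomial, C_mul_monomial, mul_one, mul_one] at h2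
  have h3 := toRF_injective h2
  rw [monomial_eq_monomial_iff] at h3
  rcases h3 with ⟨hmm, hcc⟩ | ⟨h0, -⟩
  swap; · exact absurd h0 hc
  refine ⟨hcc, ?_⟩
  have kj := congrArg (fun f : ℕ →₀ ℕ => f j) hmm
  have kj' := congrArg (fun f : ℕ →₀ ℕ => f j') hmm
  simp only [hm, hm'] at kj kj'
  by_cases hjj : j = j'
  · subst hjj
    refine ⟨rfl, ?_⟩
    cases b <;> cases b' <;> simp at kj <;> rfl
  · cases b <;> cases b' <;> simp [hjj] at kj kj'

end Substitutions

/-! ### The wheel space -/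

section WheelSpace

open MvPolynomial

variable {K₀ : Type*} [Field K₀]

variable (K₀) in
/-- **The wheel substitution** `X_j ↦ ω X_i`, `X_k ↦ ω² X_i` (an `ω`-orbit `{U, ωU, ω²U}` placed at the
three variables `i, j, k`). [cite: IkhlefPonsaing2012, §3.4 (wheel condition behind (25)–(27))] -/
noncomputable def wheelSub (ω : K₀) (i j k : ℕ) : MvPolynomial ℕ K₀ →ₐ[K₀] MvPolynomial ℕ K₀ :=
  (substHom k (C (ω ^ 2) * X i)).comp (substHom j (C ω * X i))

/-- **The wheel space.** A polynomial `G` in the window of variables `X_u, …, X_{u+L-1}` (standing for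
`U_k = z_k²`) is a WHEEL POLYNOMIAL of formal degree `D` and pair bound `B` if it is symmetric,
palindromic of formal degree `D` in each variable (`ι_n G · z_n^D = G`, so that `G = (∏ U^{D/2}) · g` for a
`BC`-symmetric Laurent polynomial `g` of width `D`), has pair sums `s_a + s_b ≤ B` on its support, and
satisfies the WHEEL CONDITION: it vanishes when three of its variables form an `ω`-orbit
`(U, ωU, ω²U)`, `ω` a primitive cube root of unity. The sum `Z` of the qKZ ground state and the
symplectic characters `χ_L` of IP12 are wheel polynomials; the space has dimension `≤ 1` for the
parameters of IP12 (`IsWheelPoly.proportional_odd/even`). [cite: IkhlefPonsaing2012, §3.4–§3.6, Prop. 3.4] -/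
structure IsWheelPoly (ω : K₀) (u L D B : ℕ) (G : MvPolynomial ℕ K₀) : Prop where
  vars : ∀ n, ¬(u ≤ n ∧ n < u + L) → G.degreeOf n = 0
  symm : ∀ a b, u ≤ a → a < u + L → u ≤ b → b < u + L → rename (Equiv.swap a b) G = G
  deg : ∀ n, u ≤ n → n < u + L → G.degreeOf n ≤ D
  pal : ∀ n, u ≤ n → n < u + L → genInv K₀ n (toRF K₀ G) * genZ K₀ n ^ D = toRF K₀ G
  pair : ∀ s ∈ G.support, ∀ a b, u ≤ a → a < u + L → u ≤ b → b < u + L → a ≠ b → s a + s b ≤ B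
  wheel : ∀ i j k, u ≤ i → i < u + L → u ≤ j → j < u + L → u ≤ k → k < u + L → i ≠ j → j ≠ k → i ≠ k →
    wheelSub K₀ ω i j k G = 0

namespace IsWheelPoly

variable {ω : K₀} {u L D B : ℕ}

/-- `0` is a wheel polynomial. [folklore] -/
theorem zero : IsWheelPoly ω u L D B (0 : MvPolynomial ℕ K₀) where
  vars n _ := by rw [degreeOf_zero]
  symm a b _ _ _ _ := by rw [map_zero]
  deg n _ _ := by rw [degreeOf_zero]; exact Nat.zero_le _
  pal n _ _ := by rw [map_zero, map_zero, zero_mul]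
  pair s hs := by simp at hs
  wheel i j k _ _ _ _ _ _ _ _ _ := by rw [map_zero]

/-- Wheel polynomials form a linear space: sums. [folklore] -/
theorem add {G₁ G₂ : MvPolynomial ℕ K₀} (h₁ : IsWheelPoly ω u L D B G₁) (h₂ : IsWheelPoly ω u L D B G₂) :
    IsWheelPoly ω u L D B (G₁ + G₂) where
  vars n hn := by
    have := degreeOf_add_le n G₁ G₂
    rw [h₁.vars n hn, h₂.vars n hn, max_self] at this
    omega
  symm a b ha haL hb hbL := by rw [map_add, h₁.symm a b ha haL hb hbL, h₂.symm a b ha haL hb hbL]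
  deg n hn hnL := (degreeOf_add_le n G₁ G₂).trans (max_le (h₁.deg n hn hnL) (h₂.deg n hn hnL))
  pal n hn hnL := by rw [map_add, map_add, add_mul, h₁.pal n hn hnL, h₂.pal n hn hnL]
  pair s hs a b ha haL hb hbL hab := by
    classical
    rcases Finset.mem_union.1 (support_add hs) with hs | hs
    · exact h₁.pair s hs a b ha haL hb hbL hab
    · exact h₂.pair s hs a b ha haL hb hbL hab
  wheel i j k hi hiL hj hjL hk hkL hij hjk hik := by
    rw [map_add, h₁.wheel i j k hi hiL hj hjL hk hkL hij hjk hik, h₂.wheel i j k hi hiL hj hjL hk hkL hij hjk hik, add_zero]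

/-- Wheel polynomials form a linear space: scalars. [folklore] -/
theorem C_mul {G : MvPolynomial ℕ K₀} (h : IsWheelPoly ω u L D B G) (c : K₀) : IsWheelPoly ω u L D B (C c * G) where
  vars n hn := by have := degreeOf_C_mul_le G n c; rw [h.vars n hn] at this; omega
  symm a b ha haL hb hbL := by rw [map_mul, rename_C, h.symm a b ha haL hb hbL]
  deg n hn hnL := (degreeOf_C_mul_le G n c).trans (h.deg n hn hnL)
  pal n hn hnL := by
    rw [map_mul, map_mul, show toRF K₀ (C c) = genC K₀ c from rfl, genInv_genC, mul_assoc, h.pal n hn hnL]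
  pair s hs a b ha haL hb hbL hab := by
    rw [← smul_eq_C_mul] at hs
    exact h.pair s (support_smul hs) a b ha haL hb hbL hab
  wheel i j k hi hiL hj hjL hk hkL hij hjk hik := by
    rw [map_mul, h.wheel i j k hi hiL hj hjL hk hkL hij hjk hik, mul_zero]

/-- Wheel polynomials form a linear space: differences. [folklore] -/
theorem sub {G₁ G₂ : MvPolynomial ℕ K₀} (h₁ : IsWheelPoly ω u L D B G₁) (h₂ : IsWheelPoly ω u L D B G₂) :
    IsWheelPoly ω u L D B (G₁ - G₂) := by
  have : G₁ - G₂ = G₁ + C (-1 : K₀) * G₂ := by rw [C_neg, C_1]; ring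
  rw [this]; exact h₁.add (h₂.C_mul _)

/-- The polynomial form of palindromicity. [folklore] -/
theorem revPoly_eq {G : MvPolynomial ℕ K₀} (h : IsWheelPoly ω u L D B G) {n : ℕ} (hn : u ≤ n) (hnL : n < u + L) :
    revPoly n D G = G :=
  revPoly_eq_self_of_genInv (h.deg n hn hnL) (h.pal n hn hnL)

/-- `ω³ = 1`. [folklore] -/
theorem cube_eq_one {ω : K₀} (hω : ω ^ 2 + ω + 1 = 0) : ω ^ 3 = 1 := by
  linear_combination (ω - 1) * hω

/-- `ω ≠ 0`. [folklore] -/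
theorem omega_ne_zero {ω : K₀} (hω : ω ^ 2 + ω + 1 = 0) : ω ≠ 0 := by
  rintro rfl; simp at hω

/-- `ω ≠ ω²` (for `ω ≠ 1`). [folklore] -/
theorem omega_ne_sq {ω : K₀} (hω : ω ^ 2 + ω + 1 = 0) (hω1 : ω ≠ 1) : ω ≠ ω ^ 2 := by
  intro h
  have : ω * (ω - 1) = 0 := by linear_combination -h
  rcases mul_eq_zero.1 this with h0 | h1
  · exact omega_ne_zero hω h0
  · exact hω1 (sub_eq_zero.1 h1)

/-- Symmetric images of the hyperplane: if `X_{u+1} ↦ ω X_u` kills a symmetric `G` then so does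
`X_j ↦ ω X_u` for every other window variable `j`. [folklore] -/
theorem res_eq_zero_of_symm {G : MvPolynomial ℕ K₀} (h : IsWheelPoly ω u L D B G) (hL : 2 ≤ L)
    (hres : substHom (u + 1) (C ω * X u) G = 0) {j : ℕ} (hj : u < j) (hjL : j < u + L) :
    substHom j (C ω * X u) G = 0 := by
  by_cases hj1 : j = u + 1
  · subst hj1; exact hres
  · have h1 := congrArg (rename (Equiv.swap (u + 1) j)) hres
    rw [rename_substHom, map_zero, Equiv.swap_apply_left, map_mul, rename_C, rename_X,
      Equiv.swap_apply_of_ne_of_ne (by omega) (by omega), h.symm (u + 1) j (by omega) (by omega) (by omega) hjL] at h1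
    exact h1

/-- The root `ω z_j` of `rapUni u G`. [folklore] -/
theorem eval_rapUni_omega_mul {G : MvPolynomial ℕ K₀} (h : IsWheelPoly ω u L D B G) (hL : 2 ≤ L)
    (hres : substHom (u + 1) (C ω * X u) G = 0) {j : ℕ} (hj : u < j) (hjL : j < u + L) :
    (rapUni K₀ u G).eval (genC K₀ ω * genZ K₀ j) = 0 := by
  have h1 := congrArg (rename (Equiv.swap u j)) (res_eq_zero_of_symm h hL hres hj hjL)
  rw [rename_substHom, map_zero, Equiv.swap_apply_right, map_mul, rename_C, rename_X, Equiv.swap_apply_left,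
    h.symm u j le_rfl (by omega) (by omega) hjL] at h1
  rw [show genC K₀ ω * genZ K₀ j = toRF K₀ (C ω * X j) by rw [map_mul]; rfl, eval_rapUni_toRF, h1, map_zero]

/-- The root `ω² z_j` of `rapUni u G`. [folklore] -/
theorem eval_rapUni_omega_sq_mul (hω : ω ^ 2 + ω + 1 = 0) {G : MvPolynomial ℕ K₀} (h : IsWheelPoly ω u L D B G)
    (hL : 2 ≤ L) (hres : substHom (u + 1) (C ω * X u) G = 0) {j : ℕ} (hj : u < j) (hjL : j < u + L) :
    (rapUni K₀ u G).eval (genC K₀ (ω ^ 2) * genZ K₀ j) = 0 := by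
  have h1 := res_eq_zero_of_symm h hL hres hj hjL
  have h2 : substHom u (C (ω ^ 2) * X j) G = 0 := by
    rw [← substHom_comp_substHom_cube (cube_eq_one hω) (show j ≠ u by omega), h1, map_zero]
  rw [show genC K₀ (ω ^ 2) * genZ K₀ j = toRF K₀ (C (ω ^ 2) * X j) by rw [map_mul]; rfl, eval_rapUni_toRF, h2, map_zero]

/-- **A wheel polynomial vanishing on the hyperplane `X_{u+1} = ω X_u` vanishes** (it has the `4(L-1)`
roots `ω^{±1} z_j^{±1}` in `X_u` against a degree `≤ D < 4(L-1)`). [cite: IkhlefPonsaing2012, proof of Prop. 3.4 (degree counting)] -/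
theorem eq_zero_of_res_eq_zero (hω : ω ^ 2 + ω + 1 = 0) (hω1 : ω ≠ 1) {G : MvPolynomial ℕ K₀}
    (h : IsWheelPoly ω u L D B G) (hL : 2 ≤ L) (hD : D < 4 * (L - 1))
    (hres : substHom (u + 1) (C ω * X u) G = 0) : G = 0 := by
  classical
  set p := rapUni K₀ u G with hp
  -- the root map
  set J : Finset ℕ := Finset.Ioo u (u + L) with hJ
  set f : J × Bool × Bool → RapidityField K₀ := fun i =>
    genC K₀ (if i.2.1 then ω else ω ^ 2) * (if i.2.2 then genZ K₀ (i.1 : ℕ) else (genZ K₀ (i.1 : ℕ))⁻¹) with hf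
  have hmemJ : ∀ j : J, u < (j : ℕ) ∧ (j : ℕ) < u + L := fun j => by
    have hj2 : (j : ℕ) ∈ Finset.Ioo u (u + L) := j.2
    exact Finset.mem_Ioo.1 hj2
  have hinj : Function.Injective f := by
    rintro ⟨j, s, b⟩ ⟨j', s', b'⟩ hjj
    have hc : (if s then ω else ω ^ 2) ≠ 0 := by
      split_ifs
      · exact omega_ne_zero hω
      · exact pow_ne_zero _ (omega_ne_zero hω)
    obtain ⟨hcc, hjj', hbb⟩ := genC_mul_genZ_inj hc hjj
    have hss : s = s' := by
      by_contra hne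
      cases s <;> cases s' <;> simp at hcc hne
      · exact omega_ne_sq hω hω1 hcc.symm
      · exact omega_ne_sq hω hω1 hcc
    subst hss; subst hbb
    have : j = j' := Subtype.ext hjj'
    subst this
    rfl
  have heval : ∀ i, p.eval (f i) = 0 := by
    rintro ⟨j, s, b⟩
    obtain ⟨hj, hjL⟩ := hmemJ j
    have hpalj := h.revPoly_eq (n := j) (by omega) hjL
    have hdegj := h.deg j (by omega) hjL
    have base : p.eval (genC K₀ (if s then ω else ω ^ 2) * genZ K₀ (j : ℕ)) = 0 := by
      cases s
      · exact eval_rapUni_omega_sq_mul hω h hL hres hj hjL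
      · exact eval_rapUni_omega_mul h hL hres hj hjL
    cases b
    · have e : f (j, s, false) = genInv K₀ j (genC K₀ (if s then ω else ω ^ 2) * genZ K₀ (j : ℕ)) := by
        simp only [hf, Bool.false_eq_true, ↓reduceIte]
        rw [map_mul, genInv_genC, genInv_genZ, Function.update_self]
      rw [e]
      exact eval_rapUni_genInv_eq_zero (by omega) hdegj hpalj base
    · simpa only [hf, ↓reduceIte] using base
  have hcard : p.natDegree < Fintype.card (J × Bool × Bool) := by
    rw [Fintype.card_prod, Fintype.card_prod, Fintype.card_bool, Fintype.card_coe, hJ, Nat.card_Ioo]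
    calc p.natDegree ≤ G.degreeOf u := natDegree_rapUni_le u G
      _ ≤ D := h.deg u le_rfl (by omega)
      _ < _ := by omega
  have hp0 : p = 0 := Polynomial.eq_zero_of_natDegree_lt_card_of_eval_eq_zero p hinj heval hcard
  exact rapUni_injective u (hp0.trans (map_zero _).symm)

end IsWheelPoly

/-! ### The restriction `X_{u+1} ↦ ω X_u` on monomials -/

variable (K₀) in
/-- **The restriction to the hyperplane `X_{u+1} = ω X_u`.** [cite: IkhlefPonsaing2012, (25)] -/
noncomputable def resEta (ω : K₀) (u : ℕ) : MvPolynomial ℕ K₀ →ₐ[K₀] MvPolynomial ℕ K₀ := substHom (u + 1) (C ω * X u)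

/-- A monomial split at `u` and `u+1`. [folklore] -/
theorem monomial_split (u : ℕ) (s : ℕ →₀ ℕ) (c : K₀) :
    monomial s c = X u ^ s u * X (u + 1) ^ s (u + 1) * monomial ((s.erase u).erase (u + 1)) c := by
  have hs : s = Finsupp.single u (s u) + (Finsupp.single (u + 1) (s (u + 1)) + (s.erase u).erase (u + 1)) := by
    conv_lhs => rw [← Finsupp.single_add_erase u s]
    congr 1
    conv_lhs => rw [← Finsupp.single_add_erase (u + 1) (s.erase u)]
    rw [Finsupp.erase_ne (show u + 1 ≠ u by omega)]
  rw [X_pow_eq_monomial, X_pow_eq_monomial, monomial_mul, monomial_mul, one_mul, one_mul, ← add_assoc] at *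
  rw [← hs]

/-- **The restriction of a monomial**: `X_u^a X_{u+1}^b m ↦ ω^b X_u^{a+b} m`. [folklore] -/
theorem resEta_monomial (ω : K₀) (u : ℕ) (s : ℕ →₀ ℕ) (c : K₀) :
    resEta K₀ ω u (monomial s c) = C (ω ^ s (u + 1)) * X u ^ (s u + s (u + 1)) * monomial ((s.erase u).erase (u + 1)) c := by
  classical
  have hfix : resEta K₀ ω u (monomial ((s.erase u).erase (u + 1)) c) = monomial ((s.erase u).erase (u + 1)) c := by
    rw [resEta, substHom, aeval_monomial, MvPolynomial.algebraMap_eq, monomial_eq]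
    congr 1
    rw [Finsupp.prod, Finsupp.prod]
    refine Finset.prod_congr rfl fun i hi => ?_
    have hi' : i ≠ u + 1 := by
      intro h; subst h
      rw [Finsupp.mem_support_iff, Finsupp.erase_same] at hi
      exact hi rfl
    rw [Function.update_of_ne hi']
  rw [monomial_split u s c, map_mul, map_mul, hfix, map_pow, map_pow, resEta, substHom_X_of_ne _ (show u ≠ u + 1 by omega),
    substHom_X_self, mul_pow, ← C_pow, pow_add]
  ring

/-- Hence `X_u^{s_u + s_{u+1}}` divides the restriction of a monomial. [folklore] -/
theorem X_pow_dvd_resEta_monomial (ω : K₀) (u : ℕ) (s : ℕ →₀ ℕ) (c : K₀) :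
    X u ^ (s u + s (u + 1)) ∣ resEta K₀ ω u (monomial s c) := by
  rw [resEta_monomial]
  exact ⟨C (ω ^ s (u + 1)) * monomial ((s.erase u).erase (u + 1)) c, by ring⟩

/-- And the `X_u`-degree of the restriction of a monomial is at most `s_u + s_{u+1}`. [folklore] -/
theorem degreeOf_resEta_monomial_le (ω : K₀) (u : ℕ) (s : ℕ →₀ ℕ) (c : K₀) :
    (resEta K₀ ω u (monomial s c)).degreeOf u ≤ s u + s (u + 1) := by
  classical
  rw [resEta_monomial]
  refine (degreeOf_mul_le _ _ _).trans ?_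
  have h1 : ((C (ω ^ s (u + 1)) : MvPolynomial ℕ K₀) * X u ^ (s u + s (u + 1))).degreeOf u ≤ s u + s (u + 1) := by
    refine (degreeOf_C_mul_le _ _ _).trans ((degreeOf_pow_le _ _ _).trans ?_)
    rw [degreeOf_X, if_pos rfl, mul_one]
  have h2 : (monomial ((s.erase u).erase (u + 1)) c).degreeOf u = 0 := by
    by_cases hc : c = 0
    · rw [hc, monomial_zero, degreeOf_zero]
    · rw [degreeOf_monomial_eq _ _ hc, Finsupp.erase_ne (show u ≠ u + 1 by omega), Finsupp.erase_same]
  omega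

/-- **Degree of a substitution that does not touch a variable.** If every `v i` has `X_n`-degree
`≤ [i = n]`, the substitution does not increase the `X_n`-degree. [folklore] -/
theorem degreeOf_aeval_le_self (v : ℕ → MvPolynomial ℕ K₀) (n : ℕ) (hw : ∀ i, (v i).degreeOf n ≤ if i = n then 1 else 0)
    (f : MvPolynomial ℕ K₀) : (aeval v f).degreeOf n ≤ f.degreeOf n := by
  classical
  refine (degreeOf_aeval_le v n (fun i => if i = n then 1 else 0) hw f).trans (Finset.sup_le fun s hs => ?_)
  calc ∑ i ∈ s.support, s i * (if i = n then 1 else 0) = ∑ i ∈ s.support, (if i = n then s i else 0) :=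
        Finset.sum_congr rfl fun i _ => by split_ifs <;> simp
    _ ≤ s n := by rw [Finset.sum_ite_eq']; split_ifs <;> simp
    _ ≤ f.degreeOf n := monomial_le_degreeOf n hs

/-- The restriction does not increase the degree in the other variables. [folklore] -/
theorem degreeOf_resEta_le (ω : K₀) {u n : ℕ} (hn : n ≠ u) (f : MvPolynomial ℕ K₀) :
    (resEta K₀ ω u f).degreeOf n ≤ f.degreeOf n := by
  classical
  refine degreeOf_aeval_le_self _ n (fun i => ?_) f
  by_cases hi : i = u + 1
  · subst hi
    rw [Function.update_self]
    refine (degreeOf_C_mul_le _ _ _).trans ?_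
    rw [degreeOf_X, if_neg hn]
    exact Nat.zero_le _
  · rw [Function.update_of_ne hi, degreeOf_X]
    by_cases hni : n = i
    · subst hni; simp
    · rw [if_neg hni]; exact Nat.zero_le _

/-- The restriction kills the variable `X_{u+1}`. [folklore] -/
theorem degreeOf_resEta_succ (ω : K₀) (u : ℕ) (f : MvPolynomial ℕ K₀) : (resEta K₀ ω u f).degreeOf (u + 1) = 0 := by
  classical
  apply Nat.eq_zero_of_le_zero
  refine (degreeOf_aeval_le _ (u + 1) (fun _ => 0) (fun i => ?_) f).trans (Finset.sup_le fun s _ => by simp)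
  by_cases hi : i = u + 1
  · subst hi
    rw [Function.update_self]
    refine (degreeOf_C_mul_le _ _ _).trans ?_
    rw [degreeOf_X, if_neg (show u + 1 ≠ u by omega)]
  · rw [Function.update_of_ne hi, degreeOf_X, if_neg (Ne.symm hi)]

/-- **The `X_u`-degree of the restriction is bounded by the `(u, u+1)` pair degree.** [folklore] -/
theorem degreeOf_resEta_le_pairDeg (ω : K₀) (u : ℕ) (f : MvPolynomial ℕ K₀) :
    (resEta K₀ ω u f).degreeOf u ≤ pairDeg u (u + 1) f := by
  classical
  conv_lhs => rw [f.as_sum, map_sum]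
  refine (degreeOf_sum_le _ _ _).trans (Finset.sup_le fun s hs => ?_)
  exact (degreeOf_resEta_monomial_le ω u s _).trans (le_pairDeg hs)

/-- **`X_u^v` divides the restriction** when every `(u, u+1)` pair sum on the support is `≥ v`. [folklore] -/
theorem X_pow_dvd_resEta (ω : K₀) (u v : ℕ) (f : MvPolynomial ℕ K₀) (hv : ∀ s ∈ f.support, v ≤ s u + s (u + 1)) :
    X u ^ v ∣ resEta K₀ ω u f := by
  classical
  conv_rhs => rw [f.as_sum, map_sum]
  exact Finset.dvd_sum fun s hs => (pow_dvd_pow _ (hv s hs)).trans (X_pow_dvd_resEta_monomial ω u s _)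

/-! ### The forced factors `(X_u - ω X_ℓ)(X_ℓ X_u - ω)` of a restriction -/

variable (K₀) in
/-- The factor at `ℓ`: `(X_u - ω X_ℓ)(X_ℓ X_u - ω)` (roots `ω z_ℓ` and `ω z_ℓ⁻¹` in `X_u`; IP12's
`k(u_u, u_ℓ)` up to a monomial). [cite: IkhlefPonsaing2012, (25)–(27)] -/
noncomputable def wheelFac (ω : K₀) (u ℓ : ℕ) : MvPolynomial ℕ K₀ := (X u - C ω * X ℓ) * (X ℓ * X u - C ω)

variable (K₀) in
/-- The product of the factors over the window `ℓ ∈ [u+2, u+2+L)`. [cite: IkhlefPonsaing2012, (27)] -/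
noncomputable def wheelE (ω : K₀) (u L : ℕ) : MvPolynomial ℕ K₀ := ∏ ℓ ∈ Finset.Ico (u + 2) (u + 2 + L), wheelFac K₀ ω u ℓ

section Factors

variable {ω : K₀} {u : ℕ}

/-- Coefficient bookkeeping: `X_u - ω X_ℓ` has the monomial `X_ℓ`. [folklore] -/
theorem coeff_single_linA (ω : K₀) {u ℓ : ℕ} (hℓ : ℓ ≠ u) :
    coeff (Finsupp.single ℓ 1) (X u - C ω * X ℓ : MvPolynomial ℕ K₀) = -ω := by
  classical
  rw [coeff_sub, coeff_C_mul, coeff_X, coeff_X, if_neg, if_pos rfl]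
  · ring
  · intro h; exact hℓ (Finsupp.single_left_injective one_ne_zero h).symm

/-- `X_ℓ X_u - ω` has the monomial `X_ℓ X_u`. [folklore] -/
theorem coeff_pair_linB (ω : K₀) (u ℓ : ℕ) :
    coeff (Finsupp.single ℓ 1 + Finsupp.single u 1) (X ℓ * X u - C ω : MvPolynomial ℕ K₀) = 1 := by
  classical
  rw [coeff_sub, coeff_C, if_neg, sub_zero, show (X ℓ * X u : MvPolynomial ℕ K₀) =
    monomial (Finsupp.single ℓ 1 + Finsupp.single u 1) 1 by rw [X, X, monomial_mul, mul_one], coeff_monomial, if_pos rfl]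
  intro h
  have := congrArg (fun f : ℕ →₀ ℕ => f ℓ) h
  by_cases hu : u = ℓ <;> simp [hu] at this

/-- `deg_{X_ℓ} (X_u - ω X_ℓ) = 1` (`ω ≠ 0`, `ℓ ≠ u`). [folklore] -/
theorem degreeOf_linA (hω0 : ω ≠ 0) {ℓ : ℕ} (hℓ : ℓ ≠ u) : (X u - C ω * X ℓ : MvPolynomial ℕ K₀).degreeOf ℓ = 1 := by
  classical
  apply le_antisymm
  · refine (degreeOf_sub_le _ _ _).trans (max_le ?_ ((degreeOf_C_mul_le _ _ _).trans ?_))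
    · rw [degreeOf_X, if_neg hℓ]; exact Nat.zero_le _
    · rw [degreeOf_X, if_pos rfl]
  · have hmem : Finsupp.single ℓ 1 ∈ (X u - C ω * X ℓ : MvPolynomial ℕ K₀).support := by
      rw [mem_support_iff, coeff_single_linA ω hℓ]; exact neg_ne_zero.2 hω0
    have := monomial_le_degreeOf ℓ hmem
    simpa using this

/-- `deg_{X_ℓ} (X_ℓ X_u - ω) = 1` (`ℓ ≠ u`). [folklore] -/
theorem degreeOf_linB (ω : K₀) {ℓ : ℕ} (hℓ : ℓ ≠ u) : (X ℓ * X u - C ω : MvPolynomial ℕ K₀).degreeOf ℓ = 1 := by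
  classical
  apply le_antisymm
  · refine (degreeOf_sub_le _ _ _).trans (max_le ((degreeOf_mul_le _ _ _).trans ?_) ?_)
    · rw [degreeOf_X, degreeOf_X, if_pos rfl, if_neg hℓ]
    · rw [degreeOf_C]; exact Nat.zero_le _
  · have hmem : Finsupp.single ℓ 1 + Finsupp.single u 1 ∈ (X ℓ * X u - C ω : MvPolynomial ℕ K₀).support := by
      rw [mem_support_iff, coeff_pair_linB]; exact one_ne_zero
    have := monomial_le_degreeOf ℓ hmem
    simpa [Finsupp.single_apply, hℓ.symm] using this

/-- The linear factors are not zero. [folklore] -/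
theorem linA_ne_zero (hω0 : ω ≠ 0) {ℓ : ℕ} (hℓ : ℓ ≠ u) : (X u - C ω * X ℓ : MvPolynomial ℕ K₀) ≠ 0 := fun h => by
  have := degreeOf_linA (K₀ := K₀) hω0 hℓ; rw [h, degreeOf_zero] at this; exact zero_ne_one this

/-- The linear factors are not zero. [folklore] -/
theorem linB_ne_zero (ω : K₀) {ℓ : ℕ} (hℓ : ℓ ≠ u) : (X ℓ * X u - C ω : MvPolynomial ℕ K₀) ≠ 0 := fun h => by
  have := degreeOf_linB (K₀ := K₀) ω hℓ; rw [h, degreeOf_zero] at this; exact zero_ne_one this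

/-- **`wheelFac ≠ 0`.** [folklore] -/
theorem wheelFac_ne_zero (hω0 : ω ≠ 0) {ℓ : ℕ} (hℓ : ℓ ≠ u) : wheelFac K₀ ω u ℓ ≠ 0 :=
  mul_ne_zero (linA_ne_zero hω0 hℓ) (linB_ne_zero ω hℓ)

/-- **`deg_{X_ℓ} wheelFac_ℓ = 2`.** [folklore] -/
theorem degreeOf_wheelFac_self (hω0 : ω ≠ 0) {ℓ : ℕ} (hℓ : ℓ ≠ u) : (wheelFac K₀ ω u ℓ).degreeOf ℓ = 2 := by
  rw [wheelFac, degreeOf_mul_eq (linA_ne_zero hω0 hℓ) (linB_ne_zero ω hℓ), degreeOf_linA hω0 hℓ, degreeOf_linB ω hℓ]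

/-- The factor at `ℓ` does not involve the other variables. [folklore] -/
theorem degreeOf_wheelFac_of_ne (ω : K₀) {u ℓ n : ℕ} (hnu : n ≠ u) (hnℓ : n ≠ ℓ) : (wheelFac K₀ ω u ℓ).degreeOf n = 0 := by
  classical
  apply Nat.eq_zero_of_le_zero
  refine (degreeOf_mul_le _ _ _).trans ?_
  have h1 : (X u - C ω * X ℓ : MvPolynomial ℕ K₀).degreeOf n = 0 := by
    apply Nat.eq_zero_of_le_zero
    refine (degreeOf_sub_le _ _ _).trans (max_le ?_ ((degreeOf_C_mul_le _ _ _).trans ?_))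
    · rw [degreeOf_X, if_neg hnu]
    · rw [degreeOf_X, if_neg hnℓ]
  have h2 : (X ℓ * X u - C ω : MvPolynomial ℕ K₀).degreeOf n = 0 := by
    apply Nat.eq_zero_of_le_zero
    refine (degreeOf_sub_le _ _ _).trans (max_le ((degreeOf_mul_le _ _ _).trans ?_) ?_)
    · rw [degreeOf_X, degreeOf_X, if_neg hnℓ, if_neg hnu]
    · rw [degreeOf_C]
  omega

/-- **`wheelE ≠ 0`.** [folklore] -/
theorem wheelE_ne_zero (hω0 : ω ≠ 0) (u L : ℕ) : wheelE K₀ ω u L ≠ 0 :=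
  Finset.prod_ne_zero_iff.2 fun ℓ hℓ => wheelFac_ne_zero hω0 (by have := (Finset.mem_Ico.1 hℓ).1; omega)

/-- **`deg_{X_ℓ} wheelE = 2` on the window.** [folklore] -/
theorem degreeOf_wheelE_self (hω0 : ω ≠ 0) {L ℓ : ℕ} (hℓ : ℓ ∈ Finset.Ico (u + 2) (u + 2 + L)) :
    (wheelE K₀ ω u L).degreeOf ℓ = 2 := by
  classical
  have hsum : ∑ ℓ' ∈ (Finset.Ico (u + 2) (u + 2 + L)).erase ℓ, (wheelFac K₀ ω u ℓ').degreeOf ℓ = 0 :=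
    Finset.sum_eq_zero fun ℓ' hℓ' => by
      have h1 := Finset.mem_erase.1 hℓ'
      exact degreeOf_wheelFac_of_ne ω (by have := (Finset.mem_Ico.1 hℓ).1; omega) h1.1.symm
  rw [wheelE, degreeOf_prod_eq _ _ fun ℓ' hℓ' => wheelFac_ne_zero hω0 (by have := (Finset.mem_Ico.1 hℓ').1; omega),
    ← Finset.add_sum_erase _ _ hℓ, degreeOf_wheelFac_self hω0 (by have := (Finset.mem_Ico.1 hℓ).1; omega), hsum]

/-- `wheelE` does not involve variables outside `{u} ∪ window`. [folklore] -/
theorem degreeOf_wheelE_of_notMem (ω : K₀) {u L n : ℕ} (hnu : n ≠ u) (hn : n ∉ Finset.Ico (u + 2) (u + 2 + L)) :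
    (wheelE K₀ ω u L).degreeOf n = 0 := by
  apply Nat.eq_zero_of_le_zero
  refine (degreeOf_prod_le _ _ _).trans ?_
  rw [Finset.sum_eq_zero fun ℓ hℓ => degreeOf_wheelFac_of_ne ω hnu (fun h => hn (h ▸ hℓ))]

/-- The supports of the linear factors. [folklore] -/
theorem support_linA_subset (ω : K₀) (u ℓ : ℕ) :
    (X u - C ω * X ℓ : MvPolynomial ℕ K₀).support ⊆ {Finsupp.single u 1, Finsupp.single ℓ 1} := by
  classical
  refine (support_sub (σ := ℕ) _ _).trans (Finset.union_subset ?_ ?_)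
  · rw [support_X]; exact Finset.singleton_subset_iff.2 (Finset.mem_insert_self _ _)
  · rw [← smul_eq_C_mul]
    refine support_smul.trans ?_
    rw [support_X]; exact Finset.singleton_subset_iff.2 (Finset.mem_insert_of_mem (Finset.mem_singleton_self _))

/-- The supports of the linear factors. [folklore] -/
theorem support_linB_subset (ω : K₀) (u ℓ : ℕ) :
    (X ℓ * X u - C ω : MvPolynomial ℕ K₀).support ⊆ {Finsupp.single ℓ 1 + Finsupp.single u 1, 0} := by
  classical
  refine (support_sub (σ := ℕ) _ _).trans (Finset.union_subset ?_ ?_)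
  · rw [show (X ℓ * X u : MvPolynomial ℕ K₀) = monomial (Finsupp.single ℓ 1 + Finsupp.single u 1) 1 by
      rw [X, X, monomial_mul, mul_one]]
    exact support_monomial_subset.trans (Finset.singleton_subset_iff.2 (Finset.mem_insert_self _ _))
  · rw [show (C ω : MvPolynomial ℕ K₀) = monomial 0 ω from rfl]
    exact support_monomial_subset.trans (Finset.singleton_subset_iff.2 (Finset.mem_insert_of_mem (Finset.mem_singleton_self _)))

/-- **The pair degree of the factor at `ℓ`** for a pair `a ≠ b` avoiding `u`: `2` if `ℓ ∈ {a, b}`, else `0`.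
[folklore] -/
theorem pairDeg_wheelFac (hω0 : ω ≠ 0) {a b ℓ : ℕ} (hab : a ≠ b) (hau : a ≠ u) (hbu : b ≠ u) (hℓ : ℓ ≠ u) :
    pairDeg a b (wheelFac K₀ ω u ℓ) = if ℓ = a ∨ ℓ = b then 2 else 0 := by
  classical
  -- the two factors have the same pair degree `[ℓ ∈ {a,b}]`
  have hval : (Finsupp.single ℓ 1 : ℕ →₀ ℕ) a + (Finsupp.single ℓ 1 : ℕ →₀ ℕ) b = if ℓ = a ∨ ℓ = b then 1 else 0 := by
    by_cases ha : ℓ = a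
    · subst ha; simp [hab]
    · by_cases hb : ℓ = b
      · subst hb; simp [ha]
      · simp [ha, hb]
  have hu0 : (Finsupp.single u 1 : ℕ →₀ ℕ) a + (Finsupp.single u 1 : ℕ →₀ ℕ) b = 0 := by
    simp [hau.symm, hbu.symm]
  have hA : pairDeg a b (X u - C ω * X ℓ : MvPolynomial ℕ K₀) = if ℓ = a ∨ ℓ = b then 1 else 0 := by
    apply le_antisymm
    · refine (Finset.sup_mono (support_linA_subset ω u ℓ)).trans ?_
      rw [Finset.sup_insert, Finset.sup_singleton, hu0, hval]; simp
    · rw [← hval]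
      exact le_pairDeg (mem_support_iff.2 (by rw [coeff_single_linA ω hℓ]; exact neg_ne_zero.2 hω0))
  have hB : pairDeg a b (X ℓ * X u - C ω : MvPolynomial ℕ K₀) = if ℓ = a ∨ ℓ = b then 1 else 0 := by
    apply le_antisymm
    · refine (Finset.sup_mono (support_linB_subset ω u ℓ)).trans ?_
      rw [Finset.sup_insert, Finset.sup_singleton, Finsupp.add_apply, Finsupp.add_apply]
      rw [show (Finsupp.single ℓ 1 : ℕ →₀ ℕ) a + (Finsupp.single u 1 : ℕ →₀ ℕ) a +
        ((Finsupp.single ℓ 1 : ℕ →₀ ℕ) b + (Finsupp.single u 1 : ℕ →₀ ℕ) b) =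
        ((Finsupp.single ℓ 1 : ℕ →₀ ℕ) a + (Finsupp.single ℓ 1 : ℕ →₀ ℕ) b) +
          ((Finsupp.single u 1 : ℕ →₀ ℕ) a + (Finsupp.single u 1 : ℕ →₀ ℕ) b) by ring, hu0, hval]
      simp
    · have hmem : Finsupp.single ℓ 1 + Finsupp.single u 1 ∈ (X ℓ * X u - C ω : MvPolynomial ℕ K₀).support :=
        mem_support_iff.2 (by rw [coeff_pair_linB]; exact one_ne_zero)
      have := le_pairDeg (a := a) (b := b) hmem
      rw [Finsupp.add_apply, Finsupp.add_apply] at this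
      rw [← hval]
      have e : (Finsupp.single u 1 : ℕ →₀ ℕ) a = 0 ∧ (Finsupp.single u 1 : ℕ →₀ ℕ) b = 0 := by
        simp [hau.symm, hbu.symm]
      rw [e.1, e.2] at this
      simpa using this
  rw [wheelFac, pairDeg_mul hab (linA_ne_zero hω0 hℓ) (linB_ne_zero ω hℓ), hA, hB]
  split_ifs <;> rfl

/-- **The pair degree of `wheelE` is `4`** for a pair of distinct window variables. [folklore] -/
theorem pairDeg_wheelE (hω0 : ω ≠ 0) {L a b : ℕ} (hab : a ≠ b) (ha : a ∈ Finset.Ico (u + 2) (u + 2 + L))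
    (hb : b ∈ Finset.Ico (u + 2) (u + 2 + L)) : pairDeg a b (wheelE K₀ ω u L) = 4 := by
  classical
  have hau : a ≠ u := by have := (Finset.mem_Ico.1 ha).1; omega
  have hbu : b ≠ u := by have := (Finset.mem_Ico.1 hb).1; omega
  rw [wheelE, pairDeg_prod hab _ _ fun ℓ hℓ => wheelFac_ne_zero hω0 (by have := (Finset.mem_Ico.1 hℓ).1; omega)]
  rw [Finset.sum_congr rfl fun ℓ hℓ => pairDeg_wheelFac hω0 hab hau hbu (by have := (Finset.mem_Ico.1 hℓ).1; omega)]
  rw [Finset.sum_ite, Finset.sum_const_zero, add_zero, Finset.sum_const, smul_eq_mul]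
  have : (Finset.Ico (u + 2) (u + 2 + L)).filter (fun ℓ => ℓ = a ∨ ℓ = b) = {a, b} := by
    ext ℓ
    simp only [Finset.mem_filter, Finset.mem_insert, Finset.mem_singleton]
    constructor
    · exact fun h => h.2
    · rintro (rfl | rfl)
      · exact ⟨ha, Or.inl rfl⟩
      · exact ⟨hb, Or.inr rfl⟩
  rw [this, Finset.card_pair hab]

/-- A transposition fixing `u` permutes the factors. [folklore] -/
theorem rename_swap_wheelFac (ω : K₀) {u a b : ℕ} (hau : a ≠ u) (hbu : b ≠ u) (ℓ : ℕ) :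
    rename (Equiv.swap a b) (wheelFac K₀ ω u ℓ) = wheelFac K₀ ω u (Equiv.swap a b ℓ) := by
  simp only [wheelFac, map_mul, map_sub, rename_X, rename_C, Equiv.swap_apply_of_ne_of_ne hau.symm hbu.symm]

/-- **`wheelE` is symmetric in the window variables.** [folklore] -/
theorem rename_swap_wheelE (ω : K₀) {u L a b : ℕ} (ha : a ∈ Finset.Ico (u + 2) (u + 2 + L))
    (hb : b ∈ Finset.Ico (u + 2) (u + 2 + L)) : rename (Equiv.swap a b) (wheelE K₀ ω u L) = wheelE K₀ ω u L := by
  have hau : a ≠ u := by have := (Finset.mem_Ico.1 ha).1; omega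
  have hbu : b ≠ u := by have := (Finset.mem_Ico.1 hb).1; omega
  rw [wheelE, map_prod]
  simp_rw [rename_swap_wheelFac ω hau hbu]
  refine Finset.prod_equiv (Equiv.swap a b) (fun ℓ => ?_) (fun ℓ _ => rfl)
  rw [Equiv.swap_apply_def]
  split_ifs with h1 h2
  · subst h1; exact ⟨fun _ => hb, fun _ => ha⟩
  · subst h2; exact ⟨fun _ => ha, fun _ => hb⟩
  · exact Iff.rfl

/-- `invSubst` on a variable. [folklore] -/
theorem invSubst_X (k n : ℕ) : invSubst K₀ k (X n) = if n = k then (genZ K₀ k)⁻¹ else genZ K₀ n := by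
  rw [invSubst, eval₂Hom_X']

/-- `invSubst` on a constant. [folklore] -/
theorem invSubst_C' (k : ℕ) (a : K₀) : invSubst K₀ k (C a) = genC K₀ a := by
  rw [invSubst, eval₂Hom_C]; rfl

/-- **The factor at `ℓ` is palindromic of formal degree `2` in `X_ℓ`.** [folklore] -/
theorem genInv_wheelFac_self (ω : K₀) {u ℓ : ℕ} (hℓ : ℓ ≠ u) :
    genInv K₀ ℓ (toRF K₀ (wheelFac K₀ ω u ℓ)) * genZ K₀ ℓ ^ 2 = toRF K₀ (wheelFac K₀ ω u ℓ) := by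
  have hz : genZ K₀ ℓ ≠ 0 := genZ_ne_zero ℓ
  rw [genInv_toRF]
  simp only [wheelFac, map_mul, map_sub, invSubst_X, invSubst_C', if_neg hℓ.symm, ite_true]
  rw [show toRF K₀ (X u) = genZ K₀ u from rfl, show toRF K₀ (X ℓ) = genZ K₀ ℓ from rfl,
    show toRF K₀ (C ω) = genC K₀ ω from rfl]
  field_simp

/-- The other factors are fixed by `ι_ℓ`. [folklore] -/
theorem genInv_wheelFac_of_ne (ω : K₀) {u ℓ n : ℕ} (hnu : n ≠ u) (hnℓ : n ≠ ℓ) :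
    genInv K₀ n (toRF K₀ (wheelFac K₀ ω u ℓ)) = toRF K₀ (wheelFac K₀ ω u ℓ) := by
  rw [genInv_toRF]
  simp only [wheelFac, map_mul, map_sub, invSubst_X, invSubst_C', if_neg hnu.symm, if_neg hnℓ.symm]
  rfl

/-- **`wheelE` is palindromic of formal degree `2` in each window variable.** [folklore] -/
theorem genInv_wheelE (ω : K₀) {u L ℓ : ℕ} (hℓ : ℓ ∈ Finset.Ico (u + 2) (u + 2 + L)) :
    genInv K₀ ℓ (toRF K₀ (wheelE K₀ ω u L)) * genZ K₀ ℓ ^ 2 = toRF K₀ (wheelE K₀ ω u L) := by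
  classical
  have hℓu : ℓ ≠ u := by have := (Finset.mem_Ico.1 hℓ).1; omega
  rw [wheelE, ← Finset.mul_prod_erase _ _ hℓ, map_mul, map_mul, map_prod, map_prod, mul_right_comm,
    genInv_wheelFac_self ω hℓu]
  congr 1
  refine Finset.prod_congr rfl fun ℓ' hℓ' => ?_
  exact genInv_wheelFac_of_ne ω hℓu (Finset.mem_erase.1 hℓ').1.symm

/-- The wheel substitution on generators. [folklore] -/
theorem wheelSub_X (ω : K₀) {i j k : ℕ} (hij : i ≠ j) (hjk : j ≠ k) (hik : i ≠ k) (n : ℕ) :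
    wheelSub K₀ ω i j k (X n) = if n = j then C ω * X i else if n = k then C (ω ^ 2) * X i else X n := by
  rw [wheelSub, AlgHom.comp_apply]
  by_cases hnj : n = j
  · subst hnj
    rw [substHom_X_self, map_mul, substHom_C, substHom_X_of_ne _ hik, if_pos rfl]
  · rw [substHom_X_of_ne _ hnj, if_neg hnj]
    by_cases hnk : n = k
    · subst hnk; rw [substHom_X_self, if_pos rfl]
    · rw [substHom_X_of_ne _ hnk, if_neg hnk]

/-- The wheel substitution sends every variable to a nonzero multiple of a variable. [folklore] -/
theorem wheelSub_X_eq (hω0 : ω ≠ 0) {i j k : ℕ} (hij : i ≠ j) (hjk : j ≠ k) (hik : i ≠ k) (n : ℕ) :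
    ∃ (c : K₀) (t : ℕ), c ≠ 0 ∧ (t = n ∨ t = i) ∧ wheelSub K₀ ω i j k (X n) = C c * X t := by
  rw [wheelSub_X ω hij hjk hik]
  split_ifs
  · exact ⟨ω, i, hω0, Or.inr rfl, rfl⟩
  · exact ⟨ω ^ 2, i, pow_ne_zero _ hω0, Or.inr rfl, rfl⟩
  · exact ⟨1, n, one_ne_zero, Or.inl rfl, by rw [C_1, one_mul]⟩

/-- **The wheel substitution at a window triple does not kill `wheelE`.** [folklore] -/
theorem wheelSub_wheelE_ne_zero (hω0 : ω ≠ 0) {u L i j k : ℕ} (hi : i ∈ Finset.Ico (u + 2) (u + 2 + L))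
    (hj : j ∈ Finset.Ico (u + 2) (u + 2 + L)) (hk : k ∈ Finset.Ico (u + 2) (u + 2 + L))
    (hij : i ≠ j) (hjk : j ≠ k) (hik : i ≠ k) : wheelSub K₀ ω i j k (wheelE K₀ ω u L) ≠ 0 := by
  classical
  have hiu : i ≠ u := by have := (Finset.mem_Ico.1 hi).1; omega
  have hju : j ≠ u := by have := (Finset.mem_Ico.1 hj).1; omega
  have hku : k ≠ u := by have := (Finset.mem_Ico.1 hk).1; omega
  have hXu : wheelSub K₀ ω i j k (X u) = X u := by rw [wheelSub_X ω hij hjk hik, if_neg hju.symm, if_neg hku.symm]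
  rw [wheelE, map_prod]
  refine Finset.prod_ne_zero_iff.2 fun ℓ hℓ => ?_
  have hℓu : ℓ ≠ u := by have := (Finset.mem_Ico.1 hℓ).1; omega
  obtain ⟨c, t, hc, ht, hXℓ⟩ := wheelSub_X_eq hω0 hij hjk hik ℓ
  have htu : t ≠ u := by rcases ht with rfl | rfl <;> assumption
  rw [wheelFac, map_mul, map_sub, map_sub, map_mul, map_mul, hXu, hXℓ]
  simp only [algHom_C, MvPolynomial.algebraMap_eq]
  refine mul_ne_zero ?_ ?_
  · rw [← mul_assoc, ← C_mul]
    exact linA_ne_zero (mul_ne_zero hω0 hc) htu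
  · intro h
    have := congrArg constantCoeff h
    simp only [map_sub, map_mul, constantCoeff_C, constantCoeff_X, mul_zero, zero_sub, map_zero, neg_eq_zero] at this
    exact hω0 this

/-- **No window variable divides `wheelE`.** [folklore] -/
theorem X_not_dvd_wheelE (hω0 : ω ≠ 0) {u L ℓ : ℕ} (hℓ : ℓ ∈ Finset.Ico (u + 2) (u + 2 + L)) :
    ¬(X ℓ : MvPolynomial ℕ K₀) ∣ wheelE K₀ ω u L := by
  classical
  have hℓu : ℓ ≠ u := by have := (Finset.mem_Ico.1 hℓ).1; omega
  rintro ⟨r, hr⟩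
  have h0 : substHom ℓ 0 (wheelE K₀ ω u L) = 0 := by rw [hr, map_mul, substHom_X_self, zero_mul]
  rw [wheelE, map_prod] at h0
  refine absurd h0 (Finset.prod_ne_zero_iff.2 fun ℓ' hℓ' => ?_)
  have hℓ'u : ℓ' ≠ u := by have := (Finset.mem_Ico.1 hℓ').1; omega
  by_cases h : ℓ' = ℓ
  · subst h
    rw [wheelFac, map_mul, map_sub, map_sub, map_mul, map_mul, substHom_X_self, substHom_X_of_ne _ hℓ'u.symm, substHom_C,
      mul_zero, sub_zero, zero_mul, zero_sub]
    exact mul_ne_zero (X_ne_zero _) (neg_ne_zero.2 (mt (C_eq_zero (σ := ℕ)).1 hω0))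
  · rw [wheelFac, map_mul, map_sub, map_sub, map_mul, map_mul, substHom_X_of_ne _ h, substHom_X_of_ne _ hℓu.symm,
      substHom_C, ← wheelFac]
    exact wheelFac_ne_zero hω0 hℓ'u

/-- **`rapUni u wheelE`**: up to the constant `∏ z_ℓ`, the monic polynomial with the roots `ω z_ℓ^{±1}`.
[folklore] -/
theorem rapUni_wheelE (ω : K₀) (u L : ℕ) :
    rapUni K₀ u (wheelE K₀ ω u L) = Polynomial.C (∏ ℓ ∈ Finset.Ico (u + 2) (u + 2 + L), genZ K₀ ℓ) *
      ∏ ℓ ∈ Finset.Ico (u + 2) (u + 2 + L),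
        ((Polynomial.X - Polynomial.C (genC K₀ ω * genZ K₀ ℓ)) *
          (Polynomial.X - Polynomial.C (genC K₀ ω * (genZ K₀ ℓ)⁻¹))) := by
  rw [wheelE, map_prod, map_prod, ← Finset.prod_mul_distrib]
  refine Finset.prod_congr rfl fun ℓ hℓ => ?_
  have hℓu : ℓ ≠ u := by have := (Finset.mem_Ico.1 hℓ).1; omega
  have hz : genZ K₀ ℓ ≠ 0 := genZ_ne_zero ℓ
  rw [wheelFac, map_mul, map_sub, map_sub, map_mul, map_mul, rapUni_X_self, rapUni_X_of_ne hℓu, rapUni_C,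
    Polynomial.C_mul, Polynomial.C_mul]
  have e : Polynomial.C (genZ K₀ ℓ) * Polynomial.C ((genZ K₀ ℓ)⁻¹) = (1 : Polynomial (RapidityField K₀)) := by
    rw [← Polynomial.C_mul, mul_inv_cancel₀ hz, Polynomial.C_1]
  linear_combination ((Polynomial.X - Polynomial.C (genC K₀ ω) * Polynomial.C (genZ K₀ ℓ)) * Polynomial.C (genC K₀ ω)) * e

end Factors

/-! ### The restriction commutes with the structure -/

section Commute

variable {ω : K₀} {u : ℕ}

/-- The restriction on generators. [folklore] -/
theorem resEta_X (ω : K₀) (u n : ℕ) : resEta K₀ ω u (X n) = if n = u + 1 then C ω * X u else X n := by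
  rw [resEta]
  by_cases h : n = u + 1
  · subst h; rw [substHom_X_self, if_pos rfl]
  · rw [substHom_X_of_ne _ h, if_neg h]

/-- Transpositions away from `u, u+1` commute with the restriction. [folklore] -/
theorem rename_swap_resEta (ω : K₀) {u a b : ℕ} (hau : a ≠ u) (hau' : a ≠ u + 1) (hbu : b ≠ u) (hbu' : b ≠ u + 1)
    (G : MvPolynomial ℕ K₀) : rename (Equiv.swap a b) (resEta K₀ ω u G) = resEta K₀ ω u (rename (Equiv.swap a b) G) := by
  rw [resEta, rename_substHom, Equiv.swap_apply_of_ne_of_ne hau'.symm hbu'.symm, map_mul, rename_C, rename_X,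
    Equiv.swap_apply_of_ne_of_ne hau.symm hbu.symm]

/-- The pair substitution on generators. [folklore] -/
theorem pairMap_X (a b n : ℕ) : pairMap K₀ a b (X n) = if n = b then X a * X b else X n := by
  classical
  rw [pairMap, aeval_X, Function.update_apply]

/-- The pair substitution away from `u, u+1` commutes with the restriction. [folklore] -/
theorem pairMap_resEta (ω : K₀) {u a b : ℕ} (hau' : a ≠ u + 1) (hbu : b ≠ u) (hbu' : b ≠ u + 1)
    (G : MvPolynomial ℕ K₀) : pairMap K₀ a b (resEta K₀ ω u G) = resEta K₀ ω u (pairMap K₀ a b G) := by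
  have key : (pairMap K₀ a b).comp (resEta K₀ ω u) = (resEta K₀ ω u).comp (pairMap K₀ a b) := by
    refine algHom_ext fun n => ?_
    rw [AlgHom.comp_apply, AlgHom.comp_apply, resEta_X, pairMap_X]
    by_cases hn : n = u + 1
    · subst hn
      rw [if_pos rfl, if_neg (Ne.symm hbu'), map_mul, algHom_C, MvPolynomial.algebraMap_eq, pairMap_X,
        if_neg (Ne.symm hbu), resEta_X, if_pos rfl]
    · rw [if_neg hn]
      by_cases hnb : n = b
      · subst hnb
        rw [if_pos rfl, pairMap_X, if_pos rfl, map_mul, resEta_X, if_neg hau', resEta_X, if_neg hn]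
      · rw [if_neg hnb, pairMap_X, if_neg hnb, resEta_X, if_neg hn]
  exact congrArg (fun φ : MvPolynomial ℕ K₀ →ₐ[K₀] MvPolynomial ℕ K₀ => φ G) key

/-- The wheel substitution away from `u, u+1` commutes with the restriction. [folklore] -/
theorem wheelSub_resEta (ω : K₀) {u i j k : ℕ} (hiu' : i ≠ u + 1) (hju : j ≠ u) (hju' : j ≠ u + 1)
    (hku : k ≠ u) (hku' : k ≠ u + 1) (hij : i ≠ j) (hjk : j ≠ k) (hik : i ≠ k) (G : MvPolynomial ℕ K₀) :
    wheelSub K₀ ω i j k (resEta K₀ ω u G) = resEta K₀ ω u (wheelSub K₀ ω i j k G) := by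
  have key : (wheelSub K₀ ω i j k).comp (resEta K₀ ω u) = (resEta K₀ ω u).comp (wheelSub K₀ ω i j k) := by
    refine algHom_ext fun n => ?_
    rw [AlgHom.comp_apply, AlgHom.comp_apply, resEta_X, wheelSub_X ω hij hjk hik]
    by_cases hn : n = u + 1
    · subst hn
      rw [if_pos rfl, if_neg hju'.symm, if_neg hku'.symm, map_mul, algHom_C, MvPolynomial.algebraMap_eq,
        wheelSub_X ω hij hjk hik, if_neg hju.symm, if_neg hku.symm, resEta_X, if_pos rfl]
    · rw [if_neg hn]
      by_cases hnj : n = j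
      · rw [if_pos hnj, wheelSub_X ω hij hjk hik, if_pos hnj, map_mul, algHom_C, MvPolynomial.algebraMap_eq, resEta_X,
          if_neg hiu']
      · rw [if_neg hnj]
        by_cases hnk : n = k
        · rw [if_pos hnk, wheelSub_X ω hij hjk hik, if_neg hnj, if_pos hnk, map_mul, algHom_C, MvPolynomial.algebraMap_eq,
            resEta_X, if_neg hiu']
        · rw [if_neg hnk, wheelSub_X ω hij hjk hik, if_neg hnj, if_neg hnk, resEta_X, if_neg hn]
  exact congrArg (fun φ : MvPolynomial ℕ K₀ →ₐ[K₀] MvPolynomial ℕ K₀ => φ G) key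

/-- **Substituting `X_u ↦ ω X_ℓ` after the restriction is the wheel substitution at `(ℓ, u, u+1)`.**
[folklore] -/
theorem substHom_resEta_eq_wheelSub (ω : K₀) {u ℓ : ℕ} (hℓu : ℓ ≠ u) (hℓu' : ℓ ≠ u + 1) (G : MvPolynomial ℕ K₀) :
    substHom u (C ω * X ℓ) (resEta K₀ ω u G) = wheelSub K₀ ω ℓ u (u + 1) G := by
  have hu1 : u ≠ u + 1 := by omega
  have key : (substHom u (C ω * X ℓ)).comp (resEta K₀ ω u) = wheelSub K₀ ω ℓ u (u + 1) := by
    refine algHom_ext fun n => ?_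
    rw [AlgHom.comp_apply, resEta_X, wheelSub_X ω hℓu hu1 hℓu']
    by_cases hn : n = u + 1
    · subst hn
      rw [if_pos rfl, if_neg (show u + 1 ≠ u by omega), if_pos rfl, map_mul, substHom_C, substHom_X_self, ← mul_assoc,
        ← C_mul, sq]
    · rw [if_neg hn]
      by_cases hnu : n = u
      · subst hnu; rw [substHom_X_self, if_pos rfl]
      · rw [substHom_X_of_ne _ hnu, if_neg hnu, if_neg hn]
  exact congrArg (fun φ : MvPolynomial ℕ K₀ →ₐ[K₀] MvPolynomial ℕ K₀ => φ G) key

/-- **The restriction of a polynomial palindromic in `X_ℓ` (`ℓ ∉ {u, u+1}`) is palindromic in `X_ℓ`**,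
in field form. [folklore] -/
theorem genInv_resEta (ω : K₀) {u ℓ D : ℕ} (hℓu : ℓ ≠ u) (hℓu' : ℓ ≠ u + 1) {G : MvPolynomial ℕ K₀}
    (hdeg : G.degreeOf ℓ ≤ D) (hpal : revPoly ℓ D G = G) :
    genInv K₀ ℓ (toRF K₀ (resEta K₀ ω u G)) * genZ K₀ ℓ ^ D = toRF K₀ (resEta K₀ ω u G) := by
  have hz : genZ K₀ ℓ ≠ 0 := genZ_ne_zero ℓ
  set h : MvPolynomial ℕ K₀ →+* RapidityField K₀ := (invSubst K₀ ℓ).comp (resEta K₀ ω u).toRingHom with hh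
  set h' : MvPolynomial ℕ K₀ →+* RapidityField K₀ := (toRF K₀).comp (resEta K₀ ω u).toRingHom with hh'
  have hrev := hom_revPoly_eq h h' ℓ D
    (fun a => by
      simp only [hh, hh', RingHom.comp_apply, AlgHom.toRingHom_eq_coe, RingHom.coe_coe, resEta, substHom_C, invSubst_C']
      rfl)
    (fun i hiℓ => by
      simp only [hh, hh', RingHom.comp_apply, AlgHom.toRingHom_eq_coe, RingHom.coe_coe, resEta_X]
      split_ifs with hi
      · rw [map_mul, map_mul, invSubst_C', invSubst_X, if_neg hℓu.symm]; rfl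
      · rw [invSubst_X, if_neg hiℓ]; rfl)
    (by
      simp only [hh, hh', RingHom.comp_apply, AlgHom.toRingHom_eq_coe, RingHom.coe_coe, resEta_X, if_neg hℓu',
        invSubst_X, ite_true]
      exact mul_inv_cancel₀ hz)
    G hdeg
  rw [hpal] at hrev
  simp only [hh, hh', RingHom.comp_apply, AlgHom.toRingHom_eq_coe, RingHom.coe_coe, resEta_X, if_neg hℓu',
    invSubst_X, ite_true] at hrev
  rw [genInv_toRF, hrev, mul_assoc, mul_comm (toRF K₀ _), ← mul_assoc, ← mul_pow, inv_mul_cancel₀ hz, one_pow, one_mul]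

end Commute

/-! ### The restriction theorem -/

section Restrict

variable {ω : K₀} {u L D B : ℕ} {G : MvPolynomial ℕ K₀}

/-- A `u`-free polynomial is a constant for `rapUni u`. [folklore] -/
theorem rapUni_eq_C_of_degreeOf_eq_zero {u : ℕ} {c : MvPolynomial ℕ K₀} (hc : c.degreeOf u = 0) :
    rapUni K₀ u c = Polynomial.C (toRF K₀ c) := by
  have h0 : (rapUni K₀ u c).natDegree = 0 := Nat.eq_zero_of_le_zero ((natDegree_rapUni_le u c).trans hc.le)
  have h1 := Polynomial.eq_C_of_natDegree_eq_zero h0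
  have h2 := eval_rapUni_genZ (K₀ := K₀) u c
  rw [h1, Polynomial.eval_C] at h2
  rw [h1, h2]

/-- **`X_u^{2D-B}` divides the restriction** (lower pair bound by double palindromicity). [folklore] -/
theorem IsWheelPoly.X_pow_dvd_res (h : IsWheelPoly ω u (L + 2) D B G) : X u ^ (2 * D - B) ∣ resEta K₀ ω u G := by
  refine X_pow_dvd_resEta ω u _ G fun s hs => ?_
  have := pair_lower_of_palindromic (show u ≠ u + 1 by omega) (h.deg u le_rfl (by omega)) (h.deg (u + 1) (by omega) (by omega))
    (h.revPoly_eq le_rfl (by omega)) (h.revPoly_eq (n := u + 1) (by omega) (by omega))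
    (fun s hs => h.pair s hs u (u + 1) le_rfl (by omega) (by omega) (by omega) (by omega)) hs
  omega

/-- **The `X_u`-degree of the restriction is `≤ B`.** [folklore] -/
theorem IsWheelPoly.degreeOf_res_le (h : IsWheelPoly ω u (L + 2) D B G) : (resEta K₀ ω u G).degreeOf u ≤ B :=
  (degreeOf_resEta_le_pairDeg ω u G).trans (pairDeg_le_iff.2 fun s hs =>
    h.pair s hs u (u + 1) le_rfl (by omega) (by omega) (by omega) (by omega))

/-- The restriction is palindromic in the remaining window variables (field form). [folklore] -/
theorem IsWheelPoly.genInv_res (h : IsWheelPoly ω u (L + 2) D B G) {ℓ : ℕ} (hℓ : ℓ ∈ Finset.Ico (u + 2) (u + 2 + L)) :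
    genInv K₀ ℓ (toRF K₀ (resEta K₀ ω u G)) * genZ K₀ ℓ ^ D = toRF K₀ (resEta K₀ ω u G) := by
  have h1 := Finset.mem_Ico.1 hℓ
  exact genInv_resEta ω (by omega) (by omega) (h.deg ℓ (by omega) (by omega)) (h.revPoly_eq (n := ℓ) (by omega) (by omega))

/-- The direct roots `ω z_ℓ` of the restriction (the wheel condition at `(ℓ, u, u+1)`). [folklore] -/
theorem IsWheelPoly.eval_rapUni_res_root (h : IsWheelPoly ω u (L + 2) D B G) {ℓ : ℕ}
    (hℓ : ℓ ∈ Finset.Ico (u + 2) (u + 2 + L)) :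
    (rapUni K₀ u (resEta K₀ ω u G)).eval (genC K₀ ω * genZ K₀ ℓ) = 0 := by
  have h1 := Finset.mem_Ico.1 hℓ
  rw [show genC K₀ ω * genZ K₀ ℓ = toRF K₀ (C ω * X ℓ) by rw [map_mul]; rfl, eval_rapUni_toRF,
    substHom_resEta_eq_wheelSub ω (by omega) (by omega),
    h.wheel ℓ u (u + 1) (by omega) (by omega) le_rfl (by omega) (by omega) (by omega) (by omega) (by omega) (by omega),
    map_zero]

/-- The reflected roots `ω z_ℓ⁻¹` of the restriction (palindromicity in `X_ℓ`). [folklore] -/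
theorem IsWheelPoly.eval_rapUni_res_root_inv (h : IsWheelPoly ω u (L + 2) D B G) {ℓ : ℕ}
    (hℓ : ℓ ∈ Finset.Ico (u + 2) (u + 2 + L)) :
    (rapUni K₀ u (resEta K₀ ω u G)).eval (genC K₀ ω * (genZ K₀ ℓ)⁻¹) = 0 := by
  have h1 := Finset.mem_Ico.1 hℓ
  have hdeg : (resEta K₀ ω u G).degreeOf ℓ ≤ D := (degreeOf_resEta_le ω (by omega) G).trans (h.deg ℓ (by omega) (by omega))
  have hpal : revPoly ℓ D (resEta K₀ ω u G) = resEta K₀ ω u G := revPoly_eq_self_of_genInv hdeg (h.genInv_res hℓ)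
  have e : genC K₀ ω * (genZ K₀ ℓ)⁻¹ = genInv K₀ ℓ (genC K₀ ω * genZ K₀ ℓ) := by
    rw [map_mul, genInv_genC, genInv_genZ, Function.update_self]
  rw [e]
  exact eval_rapUni_genInv_eq_zero (by omega) hdeg hpal (h.eval_rapUni_res_root hℓ)

/-- **The core of the restriction analysis**: `resEta G = X_u^{2D-B} G₁`, and the monic polynomial
`Dp` of degree `2L` with the roots `ω z_ℓ^{±1}` (`ℓ` in the remaining window) divides `rapUni u G₁`;
moreover `C(∏ z_ℓ) · Dp = rapUni u wheelE` and `deg_u G₁ + (2D - B) ≤ B`. [cite: IkhlefPonsaing2012, (25), (27), Prop. 3.4 (proof)] -/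
theorem IsWheelPoly.res_core (hω : ω ^ 2 + ω + 1 = 0) (h : IsWheelPoly ω u (L + 2) D B G) :
    ∃ (G₁ : MvPolynomial ℕ K₀) (Dp : Polynomial (RapidityField K₀)),
      resEta K₀ ω u G = X u ^ (2 * D - B) * G₁ ∧ Dp.Monic ∧ Dp.natDegree = 2 * L ∧ Dp ∣ rapUni K₀ u G₁ ∧
      Polynomial.C (∏ ℓ ∈ Finset.Ico (u + 2) (u + 2 + L), genZ K₀ ℓ) * Dp = rapUni K₀ u (wheelE K₀ ω u L) ∧
      (G₁ ≠ 0 → G₁.degreeOf u + (2 * D - B) ≤ B) := by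
  classical
  have hω0 : ω ≠ 0 := omega_ne_zero hω
  set v := 2 * D - B with hv
  set W : Finset ℕ := Finset.Ico (u + 2) (u + 2 + L) with hW
  -- `resEta G = X_u^v G₁`
  obtain ⟨G₁, hG₁⟩ := h.X_pow_dvd_res
  have hXv : (X u ^ v : MvPolynomial ℕ K₀) ≠ 0 := pow_ne_zero _ (X_ne_zero _)
  have hdegG₁ : G₁ ≠ 0 → G₁.degreeOf u + v ≤ B := fun hG₁0 => by
    have e := congrArg (degreeOf u) hG₁
    rw [degreeOf_mul_eq hXv hG₁0, degreeOf_X_self_pow] at e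
    have := h.degreeOf_res_le (K₀ := K₀)
    omega
  -- the `2L` distinct roots of `p₁ = rapUni u G₁`
  set p₁ := rapUni K₀ u G₁ with hp₁
  have hfac : rapUni K₀ u (resEta K₀ ω u G) = Polynomial.X ^ v * p₁ := by
    rw [hG₁, map_mul, map_pow, rapUni_X_self]
  set root : ℕ × Bool → RapidityField K₀ := fun i => genC K₀ ω * (if i.2 then genZ K₀ i.1 else (genZ K₀ i.1)⁻¹)
    with hroot
  have hroots : ∀ i ∈ W ×ˢ (Finset.univ : Finset Bool), p₁.eval (root i) = 0 := by
    rintro ⟨ℓ, b⟩ hi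
    have hℓ : ℓ ∈ W := (Finset.mem_product.1 hi).1
    have hr0 : root (ℓ, b) ≠ 0 := by
      simp only [hroot]
      refine mul_ne_zero ?_ (by split_ifs <;> simp [genZ_ne_zero])
      exact fun h0 => hω0 ((C_eq_zero (σ := ℕ)).1 (toRF_injective (h0.trans (map_zero _).symm)))
    have h0 : (rapUni K₀ u (resEta K₀ ω u G)).eval (root (ℓ, b)) = 0 := by
      cases b
      · exact h.eval_rapUni_res_root_inv hℓ
      · exact h.eval_rapUni_res_root hℓ
    rw [hfac, Polynomial.eval_mul, Polynomial.eval_pow, Polynomial.eval_X] at h0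
    exact (mul_eq_zero.1 h0).resolve_left (pow_ne_zero _ hr0)
  set Dp : Polynomial (RapidityField K₀) := ∏ i ∈ W ×ˢ (Finset.univ : Finset Bool), (Polynomial.X - Polynomial.C (root i))
    with hDp
  have hdvd : Dp ∣ p₁ := by
    refine Finset.prod_dvd_of_coprime (fun i _ i' _ hii' => ?_) (fun i hi => Polynomial.dvd_iff_isRoot.2 (hroots i hi))
    refine Polynomial.isCoprime_X_sub_C_of_isUnit_sub (sub_ne_zero.2 fun he => hii' ?_).isUnit
    obtain ⟨-, h1, h2⟩ := genC_mul_genZ_inj hω0 he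
    exact Prod.ext h1 h2
  have hDmonic : Dp.Monic := Polynomial.monic_prod_of_monic _ _ fun i _ => Polynomial.monic_X_sub_C _
  have hDdeg : Dp.natDegree = 2 * L := by
    rw [hDp, Polynomial.natDegree_prod_of_monic _ _ fun i _ => Polynomial.monic_X_sub_C _]
    simp only [Polynomial.natDegree_X_sub_C, Finset.sum_const, smul_eq_mul, mul_one]
    rw [Finset.card_product, Finset.card_univ, Fintype.card_bool, hW, Nat.card_Ico]
    omega
  have hDp' : Polynomial.C (∏ ℓ ∈ W, genZ K₀ ℓ) * Dp = rapUni K₀ u (wheelE K₀ ω u L) := by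
    rw [rapUni_wheelE ω u L, hDp, Finset.prod_product]
    congr 1
    refine Finset.prod_congr rfl fun ℓ _ => ?_
    simp only [hroot, Fintype.prod_bool, ↓reduceIte, Bool.false_eq_true]
  exact ⟨G₁, Dp, hG₁, hDmonic, hDdeg, hdvd, hDp', hdegG₁⟩

/-- **Width ≥ number of roots**: if the restriction of a wheel polynomial in `L+2` variables is not
zero then `2L ≤ B - (2D - B)`, i.e. `L + D ≤ B` when `B ≤ 2D` (the `2L` roots `ω z_ℓ^{±1}` against the
width of the restriction). With `IsWheelPoly.eq_zero_of_res_eq_zero` this is the rigorous form of "the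
degree of `Z_L` is set by the qKZ equation" (IP12 Prop. 3.4): a nonzero wheel polynomial cannot have
too small a degree. [cite: IkhlefPonsaing2012, Prop. 3.4 (proof)] -/
theorem IsWheelPoly.two_mul_le_of_res_ne_zero (hω : ω ^ 2 + ω + 1 = 0) (h : IsWheelPoly ω u (L + 2) D B G)
    (hres : resEta K₀ ω u G ≠ 0) : 2 * L + (2 * D - B) ≤ B := by
  obtain ⟨G₁, Dp, hG₁, hDmonic, hDdeg, hdvd, -, hdegG₁⟩ := h.res_core hω
  have hG₁0 : G₁ ≠ 0 := fun h0 => hres (by rw [hG₁, h0, mul_zero])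
  have hp0 : rapUni K₀ u G₁ ≠ 0 := fun h0 => hG₁0 (rapUni_injective u (h0.trans (map_zero _).symm))
  have h1 : 2 * L ≤ (rapUni K₀ u G₁).natDegree := hDdeg ▸ Polynomial.natDegree_le_of_dvd hdvd hp0
  have h2 := natDegree_rapUni_le (K₀ := K₀) u G₁
  have h3 := hdegG₁ hG₁0
  omega

/-- **The factorisation of the restriction.** For a wheel polynomial `G` in `L+2` variables with
`B ≤ L + D` (number of roots `2L ≥` width), the restriction to `X_{u+1} = ω X_u` is
`c' · X_u^{2D-B} · ∏_ℓ (X_u - ω X_ℓ)(X_ℓ X_u - ω)` with `c'` free of `X_u`. This is the mechanism of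
IP12's (25)/(27) (the restriction of `Z_L` is `∏ k(z_i, z_ℓ)` times a function of the other variables)
in the abstract. [cite: IkhlefPonsaing2012, (25), (27), Prop. 3.4 (proof)] -/
theorem IsWheelPoly.restrict_factor (hω : ω ^ 2 + ω + 1 = 0) (h : IsWheelPoly ω u (L + 2) D B G)
    (hBL : B ≤ L + D) :
    ∃ c' : MvPolynomial ℕ K₀, c'.degreeOf u = 0 ∧ resEta K₀ ω u G = c' * (X u ^ (2 * D - B) * wheelE K₀ ω u L) := by
  classical
  have hω0 : ω ≠ 0 := omega_ne_zero hω
  set v := 2 * D - B with hv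
  set W : Finset ℕ := Finset.Ico (u + 2) (u + 2 + L) with hW
  obtain ⟨G₁, Dp, hG₁, hDmonic, hDdeg, hdvd, hDp', hdegG₁⟩ := h.res_core hω
  -- `p₁ = C κ · Dp`, `κ = toRF c₀`, `c₀` free of `X_u`
  obtain ⟨c'', hc''⟩ := hdvd
  have hpdeg : (rapUni K₀ u G₁).natDegree ≤ 2 * L := by
    by_cases hG₁0 : G₁ = 0
    · rw [hG₁0, map_zero, Polynomial.natDegree_zero]; exact Nat.zero_le _
    · have := hdegG₁ hG₁0
      have := natDegree_rapUni_le (K₀ := K₀) u G₁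
      omega
  obtain ⟨κ, hκ⟩ : ∃ κ : RapidityField K₀, rapUni K₀ u G₁ = Polynomial.C κ * Dp := by
    by_cases hc0 : c'' = 0
    · exact ⟨0, by rw [hc'', hc0, mul_zero, Polynomial.C_0, zero_mul]⟩
    · have hdeg' := Polynomial.natDegree_mul hDmonic.ne_zero hc0
      rw [← hc'', hDdeg] at hdeg'
      have hc''deg : c''.natDegree = 0 := by omega
      refine ⟨c''.coeff 0, ?_⟩
      rw [hc'', mul_comm, ← Polynomial.eq_C_of_natDegree_eq_zero hc''deg]
  obtain ⟨c₀, hc₀free, hc₀⟩ := leadingCoeff_rapUni (K₀ := K₀) u G₁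
  have hκc₀ : κ = toRF K₀ c₀ := by
    rw [← hc₀, hκ]
    by_cases hκ0 : κ = 0
    · rw [hκ0, Polynomial.C_0, zero_mul, Polynomial.leadingCoeff_zero]
    · rw [Polynomial.leadingCoeff_mul, Polynomial.leadingCoeff_C, hDmonic.leadingCoeff, mul_one]
  -- the polynomial identity `G₁ · ∏ X_ℓ = c₀ · wheelE`
  have hident : G₁ * ∏ ℓ ∈ W, X ℓ = c₀ * wheelE K₀ ω u L := by
    apply rapUni_injective (K₀ := K₀) u
    rw [map_mul, map_mul, hκ, hκc₀, rapUni_eq_C_of_degreeOf_eq_zero hc₀free, ← hDp', map_prod]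
    have : ∏ ℓ ∈ W, rapUni K₀ u (X ℓ) = Polynomial.C (∏ ℓ ∈ W, genZ K₀ ℓ) := by
      rw [map_prod]
      refine Finset.prod_congr rfl fun ℓ hℓ => rapUni_X_of_ne (by have := (Finset.mem_Ico.1 hℓ).1; omega)
    rw [this]; ring
  -- peel `∏ X_ℓ` off `c₀`
  have hprod_dvd : (∏ ℓ ∈ W, (X ℓ : MvPolynomial ℕ K₀)) ∣ c₀ := by
    refine Finset.prod_dvd_of_isRelPrime (fun ℓ _ ℓ' _ hℓℓ' => ?_) (fun ℓ hℓ => ?_)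
    · change IsRelPrime (X ℓ : MvPolynomial ℕ K₀) (X ℓ')
      rw [MvPolynomial.X_prime.irreducible.isRelPrime_iff_not_dvd, X_dvd_X]
      exact hℓℓ'
    · have hdvd' : (X ℓ : MvPolynomial ℕ K₀) ∣ c₀ * wheelE K₀ ω u L :=
        ⟨G₁ * ∏ ℓ' ∈ W.erase ℓ, X ℓ', by rw [← hident, ← Finset.mul_prod_erase _ _ hℓ]; ring⟩
      exact ((MvPolynomial.X_prime (R := K₀) (σ := ℕ) (i := ℓ)).dvd_or_dvd hdvd').resolve_right (X_not_dvd_wheelE hω0 hℓ)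
  obtain ⟨c', hc'⟩ := hprod_dvd
  have hprod0 : (∏ ℓ ∈ W, (X ℓ : MvPolynomial ℕ K₀)) ≠ 0 := Finset.prod_ne_zero_iff.2 fun ℓ _ => X_ne_zero _
  have hG₁eq : G₁ = c' * wheelE K₀ ω u L := by
    apply mul_right_cancel₀ hprod0
    rw [hident, hc']; ring
  refine ⟨c', ?_, by rw [hG₁, hG₁eq]; ring⟩
  by_cases hc'0 : c' = 0
  · rw [hc'0, degreeOf_zero]
  · have e := congrArg (degreeOf u) hc'
    rw [hc₀free, degreeOf_mul_eq hprod0 hc'0] at e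
    omega

/-- **The cofactor of the restriction is a wheel polynomial** in the remaining `L` variables, of formal
degree `D - 2` and pair bound `B - 4`. [cite: IkhlefPonsaing2012, (25), (27), Prop. 3.4 (proof)] -/
theorem IsWheelPoly.of_factor (hω : ω ^ 2 + ω + 1 = 0) (h : IsWheelPoly ω u (L + 2) D B G) {c' : MvPolynomial ℕ K₀}
    (hcu : c'.degreeOf u = 0) (hE0 : resEta K₀ ω u G = c' * (X u ^ (2 * D - B) * wheelE K₀ ω u L)) :
    IsWheelPoly ω (u + 2) L (D - 2) (B - 4) c' := by
  classical
  have hω0 : ω ≠ 0 := omega_ne_zero hω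
  by_cases hc'0 : c' = 0
  · rw [hc'0]; exact IsWheelPoly.zero
  set v := 2 * D - B with hv
  set W : Finset ℕ := Finset.Ico (u + 2) (u + 2 + L) with hW
  have hXv : (X u ^ v : MvPolynomial ℕ K₀) ≠ 0 := pow_ne_zero _ (X_ne_zero _)
  set R := (X u ^ v * wheelE K₀ ω u L : MvPolynomial ℕ K₀) with hR
  have hR0 : R ≠ 0 := mul_ne_zero hXv (wheelE_ne_zero hω0 u L)
  have hdegR : ∀ n, n ≠ u → R.degreeOf n = (wheelE K₀ ω u L).degreeOf n := fun n hn => by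
    rw [hR, degreeOf_mul_eq hXv (wheelE_ne_zero hω0 u L), degreeOf_pow_eq _ _ _ (X_ne_zero _), degreeOf_X,
      if_neg hn, mul_zero, zero_add]
  have hdeg_c' : ∀ n, n ≠ u → c'.degreeOf n + (wheelE K₀ ω u L).degreeOf n = (resEta K₀ ω u G).degreeOf n :=
    fun n hn => by rw [hE0, degreeOf_mul_eq hc'0 hR0, hdegR n hn]
  have hdegW : ∀ n ∈ W, c'.degreeOf n + 2 ≤ D := fun n hnW => by
    have e := hdeg_c' n (by have := (Finset.mem_Ico.1 hnW).1; omega)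
    rw [degreeOf_wheelE_self hω0 hnW] at e
    have h1 := Finset.mem_Ico.1 hnW
    have := (degreeOf_resEta_le ω (show n ≠ u by omega) G).trans (h.deg n (by omega) (by omega))
    omega
  exact {
    vars := fun n hn => by
      by_cases hnu : n = u
      · rw [hnu]; exact hcu
      · have e := hdeg_c' n hnu
        by_cases hn1 : n = u + 1
        · subst hn1; rw [degreeOf_resEta_succ] at e; omega
        · have : (resEta K₀ ω u G).degreeOf n = 0 := Nat.eq_zero_of_le_zero
            ((degreeOf_resEta_le ω hnu G).trans (h.vars n (by omega)).le)
          omega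
    symm := fun a b ha haL hb hbL => by
      have haW : a ∈ W := Finset.mem_Ico.2 ⟨ha, haL⟩
      have hbW : b ∈ W := Finset.mem_Ico.2 ⟨hb, hbL⟩
      have e := congrArg (rename (Equiv.swap a b)) hE0
      rw [rename_swap_resEta ω (by omega) (by omega) (by omega) (by omega),
        h.symm a b (by omega) (by omega) (by omega) (by omega), hE0, map_mul, map_mul, map_pow, rename_X,
        Equiv.swap_apply_of_ne_of_ne (by omega) (by omega), rename_swap_wheelE ω haW hbW] at e
      exact (mul_right_cancel₀ hR0 e).symm
    deg := fun n hn hnL => by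
      have := hdegW n (Finset.mem_Ico.2 ⟨hn, hnL⟩)
      omega
    pal := fun n hn hnL => by
      have hnW : n ∈ W := Finset.mem_Ico.2 ⟨hn, hnL⟩
      have hD2 : 2 ≤ D := by have := hdegW n hnW; omega
      have e := h.genInv_res hnW
      rw [hE0, map_mul, map_mul, show D = (D - 2) + 2 by omega, pow_add] at e
      have hRinv : genInv K₀ n (toRF K₀ R) * genZ K₀ n ^ 2 = toRF K₀ R := by
        have e1 : toRF K₀ R = genZ K₀ u ^ v * toRF K₀ (wheelE K₀ ω u L) := by
          rw [hR, map_mul, map_pow]; rfl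
        rw [e1, map_mul, map_pow, genInv_genZ, Function.update_of_ne (show u ≠ n by omega), mul_assoc,
          genInv_wheelE ω hnW]
      have hR0' : toRF K₀ R ≠ 0 := fun h0 => hR0 (toRF_injective (h0.trans (map_zero _).symm))
      apply mul_right_cancel₀ hR0'
      calc genInv K₀ n (toRF K₀ c') * genZ K₀ n ^ (D - 2) * toRF K₀ R
          = genInv K₀ n (toRF K₀ c') * genZ K₀ n ^ (D - 2) * (genInv K₀ n (toRF K₀ R) * genZ K₀ n ^ 2) := by rw [hRinv]
        _ = genInv K₀ n (toRF K₀ c') * genInv K₀ n (toRF K₀ R) * (genZ K₀ n ^ (D - 2) * genZ K₀ n ^ 2) := by ring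
        _ = toRF K₀ c' * toRF K₀ R := e
    pair := fun s hs a b ha haL hb hbL hab => by
      have haW : a ∈ W := Finset.mem_Ico.2 ⟨ha, haL⟩
      have hbW : b ∈ W := Finset.mem_Ico.2 ⟨hb, hbL⟩
      have hpR : pairDeg a b R = 4 := by
        rw [hR, pairDeg_mul hab hXv (wheelE_ne_zero hω0 u L), pairDeg_wheelE hω0 hab haW hbW]
        have : pairDeg a b (X u ^ v : MvPolynomial ℕ K₀) = 0 := by
          apply Nat.eq_zero_of_le_zero
          rw [X_pow_eq_monomial]
          refine (Finset.sup_mono support_monomial_subset).trans ?_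
          rw [Finset.sup_singleton]
          simp [show u ≠ a by omega, show u ≠ b by omega]
        rw [this]
      have hpres : pairDeg a b (resEta K₀ ω u G) ≤ B := by
        rw [← degreeOf_pairMap hab, pairMap_resEta ω (by omega) (by omega) (by omega)]
        refine (degreeOf_resEta_le ω (show a ≠ u by omega) _).trans ?_
        rw [degreeOf_pairMap hab]
        exact pairDeg_le_iff.2 fun s hs => h.pair s hs a b (by omega) (by omega) (by omega) (by omega) hab
      rw [hE0, pairDeg_mul hab hc'0 hR0, hpR] at hpres
      have := le_pairDeg (a := a) (b := b) hs
      omega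
    wheel := fun i j k hi hiL hj hjL hk hkL hij hjk hik => by
      have hiW : i ∈ W := Finset.mem_Ico.2 ⟨hi, hiL⟩
      have hjW : j ∈ W := Finset.mem_Ico.2 ⟨hj, hjL⟩
      have hkW : k ∈ W := Finset.mem_Ico.2 ⟨hk, hkL⟩
      have e := congrArg (wheelSub K₀ ω i j k) hE0
      rw [wheelSub_resEta ω (by omega) (by omega) (by omega) (by omega) (by omega) hij hjk hik,
        h.wheel i j k (by omega) (by omega) (by omega) (by omega) (by omega) (by omega) hij hjk hik, map_zero,
        map_mul] at e
      have hWR : wheelSub K₀ ω i j k R ≠ 0 := by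
        rw [hR, map_mul, map_pow, wheelSub_X ω hij hjk hik, if_neg (show u ≠ j by omega), if_neg (show u ≠ k by omega)]
        exact mul_ne_zero hXv (wheelSub_wheelE_ne_zero hω0 hiW hjW hkW hij hjk hik)
      exact (mul_eq_zero.1 e.symm).resolve_right hWR }

/-- **The restriction theorem** (factorisation + the cofactor is a wheel polynomial in `L` variables of
formal degree `D - 2` and pair bound `B - 4`). [cite: IkhlefPonsaing2012, (25), (27), Prop. 3.4 (proof)] -/
theorem IsWheelPoly.restrict (hω : ω ^ 2 + ω + 1 = 0) (h : IsWheelPoly ω u (L + 2) D B G) (hBL : B ≤ L + D) :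
    ∃ c' : MvPolynomial ℕ K₀, IsWheelPoly ω (u + 2) L (D - 2) (B - 4) c' ∧
      resEta K₀ ω u G = c' * (X u ^ (2 * D - B) * wheelE K₀ ω u L) := by
  obtain ⟨c', hcu, hE0⟩ := h.restrict_factor hω hBL
  exact ⟨c', h.of_factor hω hcu hE0, hE0⟩

/-- If the cofactor is not zero and the remaining window is not empty, then `D ≥ 2`. [folklore] -/
theorem IsWheelPoly.two_le_of_factor (hω : ω ^ 2 + ω + 1 = 0) (h : IsWheelPoly ω u (L + 2) D B G)
    {c' : MvPolynomial ℕ K₀} (hc'0 : c' ≠ 0) (hL : 1 ≤ L)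
    (hE0 : resEta K₀ ω u G = c' * (X u ^ (2 * D - B) * wheelE K₀ ω u L)) : 2 ≤ D := by
  have hω0 : ω ≠ 0 := omega_ne_zero hω
  have hXv : (X u ^ (2 * D - B) : MvPolynomial ℕ K₀) ≠ 0 := pow_ne_zero _ (X_ne_zero _)
  have hR0 : (X u ^ (2 * D - B) * wheelE K₀ ω u L : MvPolynomial ℕ K₀) ≠ 0 := mul_ne_zero hXv (wheelE_ne_zero hω0 u L)
  have hnW : u + 2 ∈ Finset.Ico (u + 2) (u + 2 + L) := Finset.mem_Ico.2 ⟨le_rfl, by omega⟩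
  have e := congrArg (degreeOf (u + 2)) hE0
  rw [degreeOf_mul_eq hc'0 hR0, degreeOf_mul_eq hXv (wheelE_ne_zero hω0 u L), degreeOf_wheelE_self hω0 hnW,
    degreeOf_pow_eq _ _ _ (X_ne_zero _), degreeOf_X, if_neg (show u + 2 ≠ u by omega), mul_zero] at e
  have := (degreeOf_resEta_le ω (show u + 2 ≠ u by omega) G).trans (h.deg (u + 2) (by omega) (by omega))
  omega

end Restrict

/-! ### Uniqueness: the wheel spaces of IP12 are at most one-dimensional -/

section Unique

variable {ω : K₀}

/-- A polynomial all of whose variable degrees vanish is a constant. [folklore] -/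
theorem eq_C_of_forall_degreeOf_eq_zero {f : MvPolynomial ℕ K₀} (h : ∀ n, f.degreeOf n = 0) : f = C (coeff 0 f) := by
  rw [← totalDegree_eq_zero_iff_eq_C]
  apply Nat.eq_zero_of_le_zero
  refine Finset.sup_le fun s hs => ?_
  have hs0 : s = 0 := by
    ext n
    have := monomial_le_degreeOf n hs
    rw [h n] at this
    simpa using this
  rw [hs0]; simp

/-- A wheel polynomial of formal degree `0` is a constant. [folklore] -/
theorem IsWheelPoly.eq_C_of_zero {u L B : ℕ} {G : MvPolynomial ℕ K₀} (h : IsWheelPoly ω u L 0 B G) :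
    G = C (coeff 0 G) := by
  refine eq_C_of_forall_degreeOf_eq_zero fun n => ?_
  by_cases hn : u ≤ n ∧ n < u + L
  · exact Nat.eq_zero_of_le_zero (h.deg n hn.1 hn.2)
  · exact h.vars n hn

/-- Constants are proportional. [folklore] -/
theorem IsWheelPoly.proportional_of_zero {u L B : ℕ} {G₁ G₂ : MvPolynomial ℕ K₀} (h₁ : IsWheelPoly ω u L 0 B G₁)
    (h₂ : IsWheelPoly ω u L 0 B G₂) (hG₂ : G₂ ≠ 0) : ∃ γ : K₀, G₁ = C γ * G₂ := by
  have e₁ := h₁.eq_C_of_zero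
  have e₂ := h₂.eq_C_of_zero
  have hc : coeff 0 G₂ ≠ 0 := fun h0 => hG₂ (by rw [e₂, h0, C_0])
  refine ⟨coeff 0 G₁ / coeff 0 G₂, ?_⟩
  set a := coeff 0 G₁
  set b := coeff 0 G₂
  rw [e₁, e₂, ← MvPolynomial.C_mul, div_mul_cancel₀ _ hc]

/-- **The induction step of uniqueness**: restrict both, apply uniqueness in the smaller window, and
kill the difference by `eq_zero_of_res_eq_zero`. [cite: IkhlefPonsaing2012, Prop. 3.4 (proof)] -/
theorem IsWheelPoly.proportional_step (hω : ω ^ 2 + ω + 1 = 0) (hω1 : ω ≠ 1) {u L D B : ℕ}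
    (IH : ∀ c₁ c₂ : MvPolynomial ℕ K₀, IsWheelPoly ω (u + 2) L (D - 2) (B - 4) c₁ →
      IsWheelPoly ω (u + 2) L (D - 2) (B - 4) c₂ → c₂ ≠ 0 → ∃ γ : K₀, c₁ = C γ * c₂)
    {G₁ G₂ : MvPolynomial ℕ K₀} (h₁ : IsWheelPoly ω u (L + 2) D B G₁) (h₂ : IsWheelPoly ω u (L + 2) D B G₂)
    (hG₂ : G₂ ≠ 0) (hBL : B ≤ L + D) (hD : D < 4 * (L + 1)) : ∃ γ : K₀, G₁ = C γ * G₂ := by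
  have hω0 : ω ≠ 0 := omega_ne_zero hω
  obtain ⟨c₁, hc₁, e₁⟩ := h₁.restrict hω hBL
  obtain ⟨c₂, hc₂, e₂⟩ := h₂.restrict hω hBL
  have hR0 : (X u ^ (2 * D - B) * wheelE K₀ ω u L : MvPolynomial ℕ K₀) ≠ 0 :=
    mul_ne_zero (pow_ne_zero _ (X_ne_zero _)) (wheelE_ne_zero hω0 u L)
  have hres₂ : resEta K₀ ω u G₂ ≠ 0 := fun h0 =>
    hG₂ (h₂.eq_zero_of_res_eq_zero hω hω1 (by omega) (by omega) h0)
  have hc₂0 : c₂ ≠ 0 := fun h0 => hres₂ (by rw [e₂, h0, zero_mul])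
  obtain ⟨γ, hγ⟩ := IH c₁ c₂ hc₁ hc₂ hc₂0
  refine ⟨γ, ?_⟩
  have hdiff : IsWheelPoly ω u (L + 2) D B (G₁ - C γ * G₂) := h₁.sub (h₂.C_mul γ)
  have hres : resEta K₀ ω u (G₁ - C γ * G₂) = 0 := by
    rw [map_sub, map_mul, show resEta K₀ ω u (C γ) = C γ from substHom_C _ _ _, e₁, e₂, hγ]; ring
  have := hdiff.eq_zero_of_res_eq_zero hω hω1 (by omega) (by omega) hres
  exact sub_eq_zero.1 this

/-- **Uniqueness, odd windows** (`L = 2m+1`, `D = 2m`, `B = 4m-1` — the parameters of `Z_{2m+1}` and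
`χ_{2m+1}`): two wheel polynomials with these parameters are proportional.
[cite: IkhlefPonsaing2012, Prop. 3.4 (proof)] -/
theorem IsWheelPoly.proportional_odd (hω : ω ^ 2 + ω + 1 = 0) (hω1 : ω ≠ 1) :
    ∀ (m u : ℕ) {G₁ G₂ : MvPolynomial ℕ K₀}, IsWheelPoly ω u (2 * m + 1) (2 * m) (4 * m - 1) G₁ →
      IsWheelPoly ω u (2 * m + 1) (2 * m) (4 * m - 1) G₂ → G₂ ≠ 0 → ∃ γ : K₀, G₁ = C γ * G₂
  | 0, u, G₁, G₂, h₁, h₂, hG₂ => h₁.proportional_of_zero h₂ hG₂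
  | m + 1, u, G₁, G₂, h₁, h₂, hG₂ => by
    rw [show 2 * (m + 1) + 1 = (2 * m + 1) + 2 by ring] at h₁ h₂
    refine IsWheelPoly.proportional_step hω hω1 (fun c₁ c₂ hc₁ hc₂ hc₂0 => ?_) h₁ h₂ hG₂ (by omega) (by omega)
    rw [show 2 * (m + 1) - 2 = 2 * m by omega, show 4 * (m + 1) - 1 - 4 = 4 * m - 1 by omega] at hc₁ hc₂
    exact IsWheelPoly.proportional_odd hω hω1 m (u + 2) hc₁ hc₂ hc₂0

/-- **Uniqueness, even windows** (`L = 2m+2`, `D = 2m`, `B = 4m` — the parameters of `χ_{2m+2}`).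
[cite: IkhlefPonsaing2012, (26) for even `L`] -/
theorem IsWheelPoly.proportional_even (hω : ω ^ 2 + ω + 1 = 0) (hω1 : ω ≠ 1) :
    ∀ (m u : ℕ) {G₁ G₂ : MvPolynomial ℕ K₀}, IsWheelPoly ω u (2 * m + 2) (2 * m) (4 * m) G₁ →
      IsWheelPoly ω u (2 * m + 2) (2 * m) (4 * m) G₂ → G₂ ≠ 0 → ∃ γ : K₀, G₁ = C γ * G₂
  | 0, u, G₁, G₂, h₁, h₂, hG₂ => h₁.proportional_of_zero h₂ hG₂
  | m + 1, u, G₁, G₂, h₁, h₂, hG₂ => by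
    rw [show 2 * (m + 1) + 2 = (2 * m + 2) + 2 by ring] at h₁ h₂
    refine IsWheelPoly.proportional_step hω hω1 (fun c₁ c₂ hc₁ hc₂ hc₂0 => ?_) h₁ h₂ hG₂ (by omega) (by omega)
    rw [show 2 * (m + 1) - 2 = 2 * m by omega, show 4 * (m + 1) - 4 = 4 * m by omega] at hc₁ hc₂
    exact IsWheelPoly.proportional_even hω hω1 m (u + 2) hc₁ hc₂ hc₂0

/-- **No nonzero wheel polynomial with the deficient odd parameters** `(L, D, B) = (2k+3, 2k+1, 4k+2)`:
this is what excludes a ground-state sum `Z` of too small a degree (its formal degree `D` must be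
`L - 1`, IP12 Prop. 3.4: "the degree of `Z_L` … set by solving the qKZ equation").
[cite: IkhlefPonsaing2012, Prop. 3.4 (proof)] -/
theorem IsWheelPoly.eq_zero_deficient_odd (hω : ω ^ 2 + ω + 1 = 0) (hω1 : ω ≠ 1) :
    ∀ (k u : ℕ) {G : MvPolynomial ℕ K₀}, IsWheelPoly ω u (2 * k + 3) (2 * k + 1) (4 * k + 2) G → G = 0
  | 0, u, G, h => by
    rw [show 2 * 0 + 3 = 1 + 2 by ring] at h
    obtain ⟨c', hc', e⟩ := h.restrict hω (by omega)
    have hc'0 : c' = 0 := by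
      by_contra hne
      have := h.two_le_of_factor hω hne le_rfl e
      omega
    rw [hc'0, zero_mul] at e
    exact h.eq_zero_of_res_eq_zero hω hω1 (by omega) (by omega) e
  | k + 1, u, G, h => by
    rw [show 2 * (k + 1) + 3 = (2 * k + 3) + 2 by ring] at h
    obtain ⟨c', hc', e⟩ := h.restrict hω (by omega)
    rw [show 2 * (k + 1) + 1 - 2 = 2 * k + 1 by omega, show 4 * (k + 1) + 2 - 4 = 4 * k + 2 by omega] at hc'
    have hc'0 : c' = 0 := IsWheelPoly.eq_zero_deficient_odd hω hω1 k (u + 2) hc'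
    rw [hc'0, zero_mul] at e
    exact h.eq_zero_of_res_eq_zero hω hω1 (by omega) (by omega) e

end Unique

/-! ### A constructor: symmetric data at the base pair/triple suffice -/

section OfBase

variable {ω : K₀} {u L D B : ℕ} {G : MvPolynomial ℕ K₀}

/-- Renaming conjugates the wheel substitution. [folklore] -/
theorem rename_wheelSub (σ : Equiv.Perm ℕ) (ω : K₀) (i j k : ℕ) (G : MvPolynomial ℕ K₀) :
    rename σ (wheelSub K₀ ω i j k G) = wheelSub K₀ ω (σ i) (σ j) (σ k) (rename σ G) := by
  rw [wheelSub, AlgHom.comp_apply, rename_substHom, rename_substHom, wheelSub, AlgHom.comp_apply]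
  simp only [map_mul, rename_C, rename_X]

/-- **Constructor from base data**: full symmetry, degrees, palindromicity and variables, the pair bound
for the pair `(u, u+1)` and the wheel condition for the triples `(u, u+1, k)` give a wheel polynomial.
[folklore] -/
theorem IsWheelPoly.of_base
    (vars : ∀ n, ¬(u ≤ n ∧ n < u + L) → G.degreeOf n = 0)
    (symm : ∀ a b, u ≤ a → a < u + L → u ≤ b → b < u + L → rename (Equiv.swap a b) G = G)
    (deg : ∀ n, u ≤ n → n < u + L → G.degreeOf n ≤ D)
    (pal : ∀ n, u ≤ n → n < u + L → genInv K₀ n (toRF K₀ G) * genZ K₀ n ^ D = toRF K₀ G)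
    (pair : ∀ s ∈ G.support, s u + s (u + 1) ≤ B)
    (wheel : ∀ k, u + 2 ≤ k → k < u + L → wheelSub K₀ ω u (u + 1) k G = 0) :
    IsWheelPoly ω u L D B G := by
  classical
  -- the transporting permutation: `a ↦ u`, `b ↦ u+1` by two window transpositions
  have transport : ∀ a b, u ≤ a → a < u + L → u ≤ b → b < u + L → a ≠ b →
      ∃ τ : Equiv.Perm ℕ, τ a = u ∧ τ b = u + 1 ∧ rename τ G = G ∧
        (∀ n, u ≤ n → n < u + L → u ≤ τ n ∧ τ n < u + L) := by
    intro a b ha haL hb hbL hab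
    have hL2 : u + 1 < u + L := by omega
    set τ₁ : Equiv.Perm ℕ := Equiv.swap a u with hτ₁
    set b₁ := τ₁ b with hb₁
    have hb₁u : b₁ ≠ u := by
      rw [hb₁, hτ₁, Equiv.swap_apply_def]
      split_ifs with h1 h2 <;> omega
    have hb₁W : u ≤ b₁ ∧ b₁ < u + L := by
      rw [hb₁, hτ₁, Equiv.swap_apply_def]; split_ifs <;> omega
    set τ₂ : Equiv.Perm ℕ := Equiv.swap b₁ (u + 1) with hτ₂
    refine ⟨τ₁.trans τ₂, ?_, ?_, ?_, ?_⟩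
    · rw [Equiv.trans_apply, hτ₁, Equiv.swap_apply_left, hτ₂, Equiv.swap_apply_of_ne_of_ne hb₁u.symm (by omega)]
    · rw [Equiv.trans_apply, ← hb₁, hτ₂, Equiv.swap_apply_left]
    · rw [Equiv.coe_trans, ← rename_rename, symm a u ha haL le_rfl (by omega),
        symm b₁ (u + 1) hb₁W.1 hb₁W.2 (by omega) hL2]
    · intro n hn hnL
      rw [Equiv.trans_apply, hτ₂, Equiv.swap_apply_def, hτ₁, Equiv.swap_apply_def]
      split_ifs <;> omega
  refine ⟨vars, symm, deg, pal, fun s hs a b ha haL hb hbL hab => ?_, fun i j k hi hiL hj hjL hk hkL hij hjk hik => ?_⟩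
  · obtain ⟨τ, hτa, hτb, hτG, -⟩ := transport a b ha haL hb hbL hab
    have hmem : Finsupp.mapDomain τ s ∈ G.support := by
      rw [← hτG, support_rename_of_injective τ.injective]
      exact Finset.mem_image_of_mem _ hs
    have := pair _ hmem
    rwa [← hτb, ← hτa, Finsupp.mapDomain_apply τ.injective, Finsupp.mapDomain_apply τ.injective] at this
  · obtain ⟨τ, hτi, hτj, hτG, hτW⟩ := transport i j hi hiL hj hjL hij
    have hk' := hτW k hk hkL
    have hτk : τ k ≠ u ∧ τ k ≠ u + 1 := by
      constructor
      · rw [← hτi]; exact fun h => hik (τ.injective h).symm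
      · rw [← hτj]; exact fun h => hjk (τ.injective h).symm |>.elim
    have h0 := wheel (τ k) (by omega) hk'.2
    rw [← hτG, ← hτj, ← hτi, ← rename_wheelSub] at h0
    exact rename_injective _ τ.injective (h0.trans (map_zero _).symm)

end OfBase

end WheelSpace

end Literature.Probability.Percolation
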